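import Literature.MathematicalPhysics.QuantumFieldTheory.Balaban1983to89.B16RLeafRecord13LiveRstep
import Literature.MathematicalPhysics.QuantumFieldTheory.Balaban1983to89.Node00.TkNoExpansionAtRecord13

/-!
# `Balaban1983to89.B16RLeafRecord13LiveSLaw` — YM-DAG nodes N11∕N13 on the Stage-13 live-selector line, THE CONVERSE READING: 𝐑 of record neither creates
# nor repairs §2 form there — `SLaw₁₃ θ p (k+1)` FORCES the a.e. two-branch 𝐓-form of the PRE-𝐑 slot family `slotT_{k+1}` on every `χ_{k+1}(s)`-support,
# from def-R's row `rstep` alone; closed at every live witness carrying K0b's residuals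
# ([Balaban1988Convergent] p. 244, (2.17)–(2.18) p. 257, Thm 1 p. 262, (3.24)–(3.25) p. 270; [Balaban1989LargeFieldI] (0.3)–(0.4) p. 176, (i)–(ii) p. 177)

statement-level bookkeeping over published theorems with citation tags; kernel-checked compositions of tree theorems;
nothing here is a claim about the Yang–Mills mass gap.

WHAT THIS FILE RECORDS (seat dag-n11-e g7, the 𝐑-side complement of seat dag-n11-d's kernel half of the located question Q-W).  `…B16RLeafRecord13LiveRstep`
proves, on the live-selector line and from row `rstep` alone, the FORWARD step `TLaw₁₃ θ p k → SLaw₁₃ θ p (k+1)` (print's 𝐑-leaf, p. 244: 𝐑 of record integrates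
out only terms of zero fibre mass, `ρ_{k+1} = 𝐓ρ_k` a.e.).  This file proves the CONVERSE reading of the same bookkeeping: the §2 form of `ρ_{k+1}`
(`SLaw₁₃ θ p (k+1)`, node00-def-T's `HasSect2FormAEZ` of the POST-𝐑 family `slot_{k+1}`) already determines, sequence by sequence, the a.e. content of the
(3.25) identity for the PRE-𝐑 family `slotT_{k+1}`:

§1  generic `θ`, hypotheses `hrstep` (row `rstep` as its own Π-type) and «moved ⇒ dead» of the selector: ★ `slotsT_succ_aeForm_of_sLaw₁₃_succ_of_dead_of_rstep`
    — `SLaw₁₃ θ p (k+1)` ⇒ its witness `(t, E_{k+1})` (universal 𝐄-terms, `LawsRT … (k+1)` at every sequence) satisfies at EVERY `s′`: «`slotT_{k+1}(s′) = 0`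
    `dV′`-a.e. on the `χ_{k+1}(s′)`-support, OR `slotT_{k+1}(s′)(V′) = 𝐓_{k+1}(s′) exp A_{k+1}(s′)(V′)` `dV′`-a.e. there» (a moved sequence is dead, so
    `χ·slotT = 0` a.e. by def-R's `ae_eq_zero_of_self_or_fibreIntegral_eq_zero`; a fixed point has `slot = slotT` a.e. on the support by `rstep`'s third
    conjunct, and `SLaw`'s own dichotomy transfers); at a no-expansion `s′` (`Ω_{k+1}(s′) = ∅`, `χ ≡ 1`) the GUARD-FREE clause
    ★ `sLaw₁₃_succ_clause_of_Omega_empty_…` «`slotT_{k+1}(s′) =ᵐ 0 ∨ slotT_{k+1}(s′) =ᵐ 𝐓_{k+1}(s′) exp A_{k+1}(s′)`» — the `SLaw`-side twin of seat dag-n11-d's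
    `Node00.tLaw₁₃_clause_of_Omega_empty` (first branch almost everywhere instead of identically); and at level 1 the COHERENCE form
    ★ `sLaw₁₃_one_coherence_of_Omega_empty_…`: «`slotT_1(s′) =ᵐ 0` ∨ the two one-step transports of record agree a.e.» (twin of `Node00.tLaw₁₃_zero_coherence_of_Omega_empty`).
§2  at node00-def-T's selector clause `hsel : θ.ppSel = ppSelLiveOfRecord …`, from `hrstep`; and from K0b's `HasResidualsOfRecord` ALONE (the row `rstep` is a
    theorem there, `…LiveRstep.rstep₁₃_of_liveSel_of_hasResiduals`) — NO proviso field.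
§3  at K0a's re-pin `θ.liveRepin₁₃` and ★★ at the witnesses carrying K0b's residuals: the all-numerics family `theta13LiveOfNumerics n ε₂₉` (NO letter
    hypothesis), node00-def-K0a's `L`-keyed [15]-keyed member `theta13OfThm1C ε₀ ε₂₉ B₃ a₀ a₁` (K0⁗'s explicit witness family), and the witness of record
    `theta13LiveOfRecord` (ZERO hypotheses but `SLaw₁₃ θ₁₃ p (k+1)` itself).
§4  the NODE-CONJUNCT faces: at a world bound to the C-binding of a Stage-13 (v1.2 `Sep`) record, N11's conclusion `densitiesDescribed (leavesP w P)` IS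
    `∀ k ≤ K, SLaw₁₃ θ P k` (`densitiesDescribed_leavesP_iff_sLaw₁₃_all_sep`), hence carries the level-1 clause at the all-large-field sequence of every run
    with `0 < K`; and `Dag.B14_main (leavesP w P)` with its in-edge leaves, the small-field implication, the flow control and the interval hypothesis read TRUE
    gives the same (the 𝐑-antecedent is `…LiveRstep`'s closed theorem on this line).

WHY (one paragraph).  Seat dag-n11-d's `Thm/BalabanUVNodesN11NoExpansionRoughFibre` ∕ `…AllLargeFieldLabel` derive from `TLaw₁₃ θ p 0` alone, at every witness,
Haar-null events for the rough coarse fields (the regularity cut `χreg_0(𝐓)` of the §2 operand kills the right-hand side of (3.25) over rough averages, while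
def-T's all-large-field slot is the transport of `ρ₀`).  Their input is exactly the level-1 clause at `Ω₁(s′) = ∅` with an a.e. right branch.  This file shows
the SAME clause (with an a.e. LEFT branch, which their argument tolerates) is forced by `SLaw₁₃ θ p 1` on the live line — i.e. by N11's node CONCLUSION
`densitiesDescribed` at the K0-lane witnesses (all live re-pins), not only by the (S1ᵀ) route to it: on that line no 𝐑 of record can supply §2 form that the
𝐓-image lacks.  HONEST SCOPE: necessary conditions, bookkeeping over def-R ∕ def-T ∕ K0a ∕ K0b objects; nothing of Bałaban is asserted or refuted; N11 ∕ K1⁗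
neither discharged nor refuted; count-neutral.
-/

noncomputable section

open MeasureTheory
open scoped BigOperators Matrix.Norms.L2Operator

namespace Literature.MathematicalPhysics.QuantumFieldTheory.Balaban1983to89.B16RLeafRecord13LiveSLaw

open T4Continuum T4DatumAssembly Node00 B14.Eq218Concrete DagBinding
open B16RLeafRecord11 B16RLeafRecord12 B16RLeafRecord12Live B16RLeafRecord12AtLive
open B16RLeafRecord13Live B16RLeafRecord13AtLive B16RLeafRecord13LiveRstep

variable (F : T4Family) (N : ℕ) [NeZero N]

/-! ## §1  Generic `θ`, from row `rstep` and «moved ⇒ dead»: `SLaw₁₃ (k+1)` ⇒ the a.e. two-branch 𝐓-form of `slotT_{k+1}` -/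

section RstepOnly

variable (θ : Stage13Params F N) (p : B12.RunParams)

/-- **★ `SLaw₁₃ θ p (k+1)` FORCES THE a.e. TWO-BRANCH 𝐓-FORM OF THE PRE-𝐑 FAMILY, dead-moving branch, from row `rstep` alone** (`k < K`): the witness
`(t, E_{k+1})` of the §2 form of `ρ_{k+1}` (universal 𝐄-terms, `LawsRT … (k+1)` at every sequence) satisfies at EVERY new sequence `s′`: EITHER
`slotT_{k+1}(s′)(V′) = 0` for `dV′`-a.e. `V′` on the `χ_{k+1}(s′)`-support (in particular at every moved — hence dead — sequence, def-R's
`ae_eq_zero_of_self_or_fibreIntegral_eq_zero` on `rstep`'s integrability and sign rows), OR the (3.25) identity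
`slotT_{k+1}(s′)(V′) = 𝐓_{k+1}(s′) exp A_{k+1}(s′)(V′)` for `dV′`-a.e. `V′` there (a fixed point: `slot = slotT` a.e. on the support by `rstep`'s third row, and
`SLaw`'s dichotomy read through it). [cite: Balaban1988Convergent, (2.17)–(2.18) p.257, Thm 1 p.262, (3.24)–(3.25) p.270; Balaban1989LargeFieldI, (0.3) p.176, p.177 (i)–(ii)] -/
theorem slotsT_succ_aeForm_of_sLaw₁₃_succ_of_dead_of_rstep
    (hrstep : ∀ (p : B12.RunParams) (k : ℕ) [DecidableEq (PBond (F.P p.K) (k + 1))], k < p.K →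
      (towerRepOfRecord F N θ.ν θ.τ9 (slotsTOfRecord F N θ.ν θ.τ9 (EOfRecord₁₃ F N θ) (wOfRecord₉ F N θ.toStage9Params) θ.ppSel)
        θ.ppSel p (gOfRecord₁₃ F N θ p) (k + 1)).toRepData.ProvisosInt)
    (k : ℕ) (hk : k < p.K)
    (hdead : ∀ a, θ.ppSel p (gOfRecord₁₃ F N θ p) (k + 1) a ≠ a →
      ∀ V, B15.BasicStep.fibreIntegral (fibOfSeq F θ.ν θ.τ9 p (gOfRecord₁₃ F N θ p) (k + 1) a)
        (rterm (sliceOfRecord F N θ.ν θ.τ9.M p (gOfRecord₁₃ F N θ p) (k + 1)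
          (slotsTOfRecord F N θ.ν θ.τ9 (EOfRecord₁₃ F N θ) (wOfRecord₉ F N θ.toStage9Params) θ.ppSel p (gOfRecord₁₃ F N θ p) (k + 1))) a) V = 0)
    (hS : SLaw₁₃ F N θ p (k + 1)) :
    ∃ (t : SeqOfRecord F θ.ν θ.τ9.M (gOfRecord₁₃ F N θ p) p.K (k + 1) → Sect2.TermValues (F.P p.K) (MatA N) (FluctV N) θ.τ9.M)
      (Ek : SeqOfRecord F θ.ν θ.τ9.M (gOfRecord₁₃ F N θ p) p.K (k + 1) → ℝ), Sect2.UniversalE t ∧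
      ∀ s, Sect2.LawsRT (sect2TowerOfRecord F N (FluctV N) p.K (settingOfRecord₁₃ F N θ p) (θ.Rz p.K) s (t s)) (settingOfRecord₁₃ F N θ p).lf (k + 1) ∧
        ((∀ᵐ V ∂(fieldMeasure (F.P p.K) (k + 1) (SU N)), chiSeqOfRecord F N θ.ν θ.τ9.M (gOfRecord₁₃ F N θ p) p.K (k + 1) s V ≠ 0 →
            slotsTOfRecord F N θ.ν θ.τ9 (EOfRecord₁₃ F N θ) (wOfRecord₉ F N θ.toStage9Params) θ.ppSel p (gOfRecord₁₃ F N θ p) (k + 1) s V = 0) ∨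
          ∀ᵐ V ∂(fieldMeasure (F.P p.K) (k + 1) (SU N)), chiSeqOfRecord F N θ.ν θ.τ9.M (gOfRecord₁₃ F N θ p) p.K (k + 1) s V ≠ 0 →
            slotsTOfRecord F N θ.ν θ.τ9 (EOfRecord₁₃ F N θ) (wOfRecord₉ F N θ.toStage9Params) θ.ppSel p (gOfRecord₁₃ F N θ p) (k + 1) s V
              = sect2Slot F N (FluctV N) p.K (settingOfRecord₁₃ F N θ p) (θ.Rz p.K) (WtOfRecord₁₃ F N θ p) s (t s) (Ek s)
                  (UbgOfRecord₁₃ F N θ p (k + 1) s) V) := by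
  obtain ⟨t, Ek, hu, hs⟩ := (sLaw₁₃_iff F N θ p (k + 1)).mp hS
  refine ⟨t, Ek, hu, fun s => ⟨(hs s).1, ?_⟩⟩
  have HP := hrstep p k hk
  by_cases hfix : θ.ppSel p (gOfRecord₁₃ F N θ p) (k + 1) s = s
  · -- a fixed point: `slot_{k+1}(s) = slotT_{k+1}(s)` a.e. on the `χ_{k+1}(s)`-support
    have hae := slotsOfRecord₁₃_succ_ae_eq_slotsT_of_fix_of_dead_of_rstep F N θ p hrstep k hk s hfix
      (fun a ha hne => hdead a fun heq => hne (heq.symm.trans ha))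
    rcases (hs s).2 with h0 | hid
    · refine Or.inl ?_
      filter_upwards [hae] with V hV hχ
      rw [← hV hχ, h0, Pi.zero_apply]
    · refine Or.inr ?_
      filter_upwards [hae, hid] with V hV hVid hχ
      rw [← hV hχ]
      exact hVid hχ
  · -- a moved sequence is dead: `χ_{k+1}(s)·slotT_{k+1}(s) = 0` a.e.
    refine Or.inl ?_
    have hi : Integrable (fun V => chiSeqOfRecord F N θ.ν θ.τ9.M (gOfRecord₁₃ F N θ p) p.K (k + 1) s V *
        slotsTOfRecord F N θ.ν θ.τ9 (EOfRecord₁₃ F N θ) (wOfRecord₉ F N θ.toStage9Params) θ.ppSel p (gOfRecord₁₃ F N θ p) (k + 1) s V)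
        (fieldMeasure (F.P p.K) (k + 1) (SU N)) := HP.1 s
    have h0 : ∀ᵐ V ∂(fieldMeasure (F.P p.K) (k + 1) (SU N)), 0 ≤ chiSeqOfRecord F N θ.ν θ.τ9.M (gOfRecord₁₃ F N θ p) p.K (k + 1) s V *
        slotsTOfRecord F N θ.ν θ.τ9 (EOfRecord₁₃ F N θ) (wOfRecord₉ F N θ.toStage9Params) θ.ppSel p (gOfRecord₁₃ F N θ p) (k + 1) s V := HP.2.1 s
    have hae := B15.BasicStep.ae_eq_zero_of_self_or_fibreIntegral_eq_zero
      (fibOfSeq F θ.ν θ.τ9 p (gOfRecord₁₃ F N θ p) (k + 1) s) hi h0 (fun V => Or.inr (by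
        have H := hdead s hfix V
        convert H using 2
        rfl))
    filter_upwards [hae] with V hV hχ
    have hV' : chiSeqOfRecord F N θ.ν θ.τ9.M (gOfRecord₁₃ F N θ p) p.K (k + 1) s V *
        slotsTOfRecord F N θ.ν θ.τ9 (EOfRecord₁₃ F N θ) (wOfRecord₉ F N θ.toStage9Params) θ.ppSel p (gOfRecord₁₃ F N θ p) (k + 1) s V = 0 := hV
    exact (mul_eq_zero.mp hV').resolve_left hχ

/-- **★ THE `SLaw`-SIDE CLAUSE AT A NO-EXPANSION `s′`, GUARD-FREE, dead-moving branch, from row `rstep` alone** (`k < K`): if `SLaw₁₃ θ p (k+1)` holds, its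
witness satisfies at `s′` with `Ω_{k+1}(s′) = ∅` «`slotT_{k+1}(s′) = 0` `dV′`-a.e., or `slotT_{k+1}(s′)(V′) = 𝐓_{k+1}(s′) exp A_{k+1}(s′)(V′)` `dV′`-a.e.» —
`χ_{k+1}(s′) ≡ 1` there (`Node00.chiSeqOfRecord_eq_one_of_Omega_empty`).  The twin of seat dag-n11-d's `Node00.tLaw₁₃_clause_of_Omega_empty` with `SLaw₁₃ (k+1)`
for `TLaw₁₃ k`, `LawsRT (k+1)` for `LawsT k`, and the absent branch almost everywhere. [cite: Balaban1988Convergent, (3.25) p.270, remark p.262, Theorem p.245, (2.17)–(2.18) p.257; Balaban1989LargeFieldI, (0.3) p.176] -/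
theorem sLaw₁₃_succ_clause_of_Omega_empty_of_dead_of_rstep
    (hrstep : ∀ (p : B12.RunParams) (k : ℕ) [DecidableEq (PBond (F.P p.K) (k + 1))], k < p.K →
      (towerRepOfRecord F N θ.ν θ.τ9 (slotsTOfRecord F N θ.ν θ.τ9 (EOfRecord₁₃ F N θ) (wOfRecord₉ F N θ.toStage9Params) θ.ppSel)
        θ.ppSel p (gOfRecord₁₃ F N θ p) (k + 1)).toRepData.ProvisosInt)
    {k : ℕ} (hk : k < p.K)
    (hdead : ∀ a, θ.ppSel p (gOfRecord₁₃ F N θ p) (k + 1) a ≠ a →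
      ∀ V, B15.BasicStep.fibreIntegral (fibOfSeq F θ.ν θ.τ9 p (gOfRecord₁₃ F N θ p) (k + 1) a)
        (rterm (sliceOfRecord F N θ.ν θ.τ9.M p (gOfRecord₁₃ F N θ p) (k + 1)
          (slotsTOfRecord F N θ.ν θ.τ9 (EOfRecord₁₃ F N θ) (wOfRecord₉ F N θ.toStage9Params) θ.ppSel p (gOfRecord₁₃ F N θ p) (k + 1))) a) V = 0)
    (hS : SLaw₁₃ F N θ p (k + 1))
    (s : SeqOfRecord F θ.ν θ.τ9.M (gOfRecord₁₃ F N θ p) p.K (k + 1)) (hΩ : s.Ω (k + 1) = ∅) :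
    ∃ (t : SeqOfRecord F θ.ν θ.τ9.M (gOfRecord₁₃ F N θ p) p.K (k + 1) → Sect2.TermValues (F.P p.K) (MatA N) (FluctV N) θ.τ9.M)
      (Ek : SeqOfRecord F θ.ν θ.τ9.M (gOfRecord₁₃ F N θ p) p.K (k + 1) → ℝ),
      Sect2.UniversalE t ∧
      (∀ s', Sect2.LawsRT (sect2TowerOfRecord F N (FluctV N) p.K (settingOfRecord₁₃ F N θ p) (θ.Rz p.K) s' (t s'))
        (settingOfRecord₁₃ F N θ p).lf (k + 1)) ∧
      ((slotsTOfRecord F N θ.ν θ.τ9 (EOfRecord₁₃ F N θ) (wOfRecord₉ F N θ.toStage9Params) θ.ppSel p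
          (gOfRecord₁₃ F N θ p) (k + 1) s =ᵐ[fieldMeasure (F.P p.K) (k + 1) (SU N)] 0) ∨
        ∀ᵐ V' ∂fieldMeasure (F.P p.K) (k + 1) (SU N),
          slotsTOfRecord F N θ.ν θ.τ9 (EOfRecord₁₃ F N θ) (wOfRecord₉ F N θ.toStage9Params) θ.ppSel p
              (gOfRecord₁₃ F N θ p) (k + 1) s V' =
            sect2Slot F N (FluctV N) p.K (settingOfRecord₁₃ F N θ p) (θ.Rz p.K) (WtOfRecord₁₃ F N θ p) s (t s) (Ek s)
              (UbgOfRecord₁₃ F N θ p (k + 1) s) V') := by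
  obtain ⟨t, Ek, hu, hs⟩ := slotsT_succ_aeForm_of_sLaw₁₃_succ_of_dead_of_rstep F N θ p hrstep k hk hdead hS
  refine ⟨t, Ek, hu, fun s' => (hs s').1, ?_⟩
  have h1 : ∀ V', chiSeqOfRecord F N θ.ν θ.τ9.M (gOfRecord₁₃ F N θ p) p.K (k + 1) s V' ≠ 0 := fun V' => by
    rw [chiSeqOfRecord_eq_one_of_Omega_empty F N θ.ν θ.τ9.M _ p.K (k + 1) s hΩ V']; exact one_ne_zero
  rcases (hs s).2 with h0 | hid
  · refine Or.inl ?_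
    filter_upwards [h0] with V' hV'
    exact hV' (h1 V')
  · refine Or.inr ?_
    filter_upwards [hid] with V' hV'
    exact hV' (h1 V')

/-- **★ THE LEVEL-1 NO-EXPANSION COHERENCE EQUATION FROM THE `SLaw`-SIDE CLAUSE, IN KERNEL** (twin of seat dag-n11-d's `Node00.tLaw₁₃_zero_coherence_of_Omega_empty`,
absent branch a.e.): at `s′` with `Ω₁(s′) = ∅`, for a pair `(t, E_1)` of the a.e. clause and under the displayed measurability∕boundedness of the no-expansion
integrand (`0 < K`), EITHER `slotT_1(s′) =ᵐ 0` OR the two ONE-STEP TRANSPORTS OF RECORD agree `dV₁`-a.e.: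
`∫dU δ(ŪV₁⁻¹) w(s′)(U,V₁)·ρ₀(U) = ∫dU δ(ŪV₁⁻¹) ζ0_0(T)·χreg_0(T)·e^{−½quad_0(∅)}·exp A_1(s′)(U_1) (U, V₁)`. [cite: Balaban1988Convergent, Theorem p.245, (3.1) p.264, (3.25) p.270, (2.21)–(2.23) p.258] -/
theorem sLaw₁₃_one_coherence_of_Omega_empty (hK : 0 < p.K)
    (s : SeqOfRecord F θ.ν θ.τ9.M (gOfRecord₁₃ F N θ p) p.K 1) (hΩ : s.Ω 1 = ∅)
    (t : Sect2.TermValues (F.P p.K) (MatA N) (FluctV N) θ.τ9.M) (Ek : ℝ)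
    (hcl : (slotsTOfRecord F N θ.ν θ.τ9 (EOfRecord₁₃ F N θ) (wOfRecord₉ F N θ.toStage9Params) θ.ppSel p
          (gOfRecord₁₃ F N θ p) 1 s =ᵐ[fieldMeasure (F.P p.K) 1 (SU N)] 0) ∨
        ∀ᵐ V1 ∂fieldMeasure (F.P p.K) 1 (SU N),
          slotsTOfRecord F N θ.ν θ.τ9 (EOfRecord₁₃ F N θ) (wOfRecord₉ F N θ.toStage9Params) θ.ppSel p
              (gOfRecord₁₃ F N θ p) 1 s V1 =
            sect2Slot F N (FluctV N) p.K (settingOfRecord₁₃ F N θ p) (θ.Rz p.K) (WtOfRecord₁₃ F N θ p) s t Ek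
              (UbgOfRecord₁₃ F N θ p 1 s) V1)
    {C : ℝ}
    (hm : Measurable (Function.uncurry (noExpIntegrand F N (FluctV N) p.K (WtOfRecord₁₃ F N θ p)
      (sect2Operand F N (FluctV N) p.K (settingOfRecord₁₃ F N θ p) (θ.Rz p.K) s t Ek (UbgOfRecord₁₃ F N θ p 1 s)))))
    (hC : ∀ V1 Uf, |noExpIntegrand F N (FluctV N) p.K (WtOfRecord₁₃ F N θ p)
      (sect2Operand F N (FluctV N) p.K (settingOfRecord₁₃ F N θ p) (θ.Rz p.K) s t Ek (UbgOfRecord₁₃ F N θ p 1 s)) V1 Uf| ≤ C) :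
    (slotsTOfRecord F N θ.ν θ.τ9 (EOfRecord₁₃ F N θ) (wOfRecord₉ F N θ.toStage9Params) θ.ppSel p
        (gOfRecord₁₃ F N θ p) 1 s =ᵐ[fieldMeasure (F.P p.K) 1 (SU N)] 0) ∨
      (fun V1 => transportOfRecord F N p.K 0 (fun U => wOfRecord₉ F N θ.toStage9Params p (gOfRecord₁₃ F N θ p) 0 s U V1 *
          rhoZeroOfRecord F N p.K (gOfRecord₁₃ F N θ p 0) (EOfRecord₁₃ F N θ p) U) V1)
        =ᵐ[fieldMeasure (F.P p.K) 1 (SU N)]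
      fun V1 => transportOfRecord F N p.K 0 (noExpIntegrand F N (FluctV N) p.K (WtOfRecord₁₃ F N θ p)
        (sect2Operand F N (FluctV N) p.K (settingOfRecord₁₃ F N θ p) (θ.Rz p.K) s t Ek (UbgOfRecord₁₃ F N θ p 1 s)) V1) V1 := by
  rcases hcl with h0 | hid
  · exact Or.inl h0
  · refine Or.inr ?_
    filter_upwards [hid, sect2Slot_one_ae_eq_transport_of_Omega_empty₁₃ θ p hK s hΩ t Ek (UbgOfRecord₁₃ F N θ p 1 s) hm hC] with V1 h1 h2
    rw [← slotsTOfRecord_one_apply, h1, h2]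

end RstepOnly

/-! ## §2  AT node00-def-T's SELECTOR CLAUSE `hsel`: the converse from row `rstep` alone; and from K0b's `HasResidualsOfRecord` alone -/

section LiveSel

variable (θ : Stage13Params F N) (p : B12.RunParams)

/-- **★ AT THE LIVE SELECTOR, `SLaw₁₃ θ p (k+1)` ⇒ the a.e. two-branch 𝐓-form of `slotT_{k+1}`, FROM ROW `rstep` ALONE** («moved ⇒ dead» is
`…B16RLeafRecord13Live.dead_of_ppSel_succ_ne_of_liveSel`). [cite: Balaban1988Convergent, (2.17)–(2.18) p.257, Thm 1 p.262, (3.24)–(3.25) p.270; Balaban1989LargeFieldI, (0.3) p.176, p.177 (i)–(ii)] -/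
theorem slotsT_succ_aeForm_of_sLaw₁₃_succ_of_liveSel_of_rstep
    (hrstep : ∀ (p : B12.RunParams) (k : ℕ) [DecidableEq (PBond (F.P p.K) (k + 1))], k < p.K →
      (towerRepOfRecord F N θ.ν θ.τ9 (slotsTOfRecord F N θ.ν θ.τ9 (EOfRecord₁₃ F N θ) (wOfRecord₉ F N θ.toStage9Params) θ.ppSel)
        θ.ppSel p (gOfRecord₁₃ F N θ p) (k + 1)).toRepData.ProvisosInt)
    (hsel : θ.ppSel = ppSelLiveOfRecord F N θ.ν θ.τ9 (EOfRecord₁₃ F N θ) (wOfRecord₉ F N θ.toStage9Params)) (k : ℕ) (hk : k < p.K) (hS : SLaw₁₃ F N θ p (k + 1)) :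
    ∃ (t : SeqOfRecord F θ.ν θ.τ9.M (gOfRecord₁₃ F N θ p) p.K (k + 1) → Sect2.TermValues (F.P p.K) (MatA N) (FluctV N) θ.τ9.M)
      (Ek : SeqOfRecord F θ.ν θ.τ9.M (gOfRecord₁₃ F N θ p) p.K (k + 1) → ℝ), Sect2.UniversalE t ∧
      ∀ s, Sect2.LawsRT (sect2TowerOfRecord F N (FluctV N) p.K (settingOfRecord₁₃ F N θ p) (θ.Rz p.K) s (t s)) (settingOfRecord₁₃ F N θ p).lf (k + 1) ∧
        ((∀ᵐ V ∂(fieldMeasure (F.P p.K) (k + 1) (SU N)), chiSeqOfRecord F N θ.ν θ.τ9.M (gOfRecord₁₃ F N θ p) p.K (k + 1) s V ≠ 0 →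
            slotsTOfRecord F N θ.ν θ.τ9 (EOfRecord₁₃ F N θ) (wOfRecord₉ F N θ.toStage9Params) θ.ppSel p (gOfRecord₁₃ F N θ p) (k + 1) s V = 0) ∨
          ∀ᵐ V ∂(fieldMeasure (F.P p.K) (k + 1) (SU N)), chiSeqOfRecord F N θ.ν θ.τ9.M (gOfRecord₁₃ F N θ p) p.K (k + 1) s V ≠ 0 →
            slotsTOfRecord F N θ.ν θ.τ9 (EOfRecord₁₃ F N θ) (wOfRecord₉ F N θ.toStage9Params) θ.ppSel p (gOfRecord₁₃ F N θ p) (k + 1) s V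
              = sect2Slot F N (FluctV N) p.K (settingOfRecord₁₃ F N θ p) (θ.Rz p.K) (WtOfRecord₁₃ F N θ p) s (t s) (Ek s)
                  (UbgOfRecord₁₃ F N θ p (k + 1) s) V) :=
  slotsT_succ_aeForm_of_sLaw₁₃_succ_of_dead_of_rstep F N θ p hrstep k hk (fun a hne V => dead_of_ppSel_succ_ne_of_liveSel F N θ hsel p k a hne V) hS

/-- **★ AT THE LIVE SELECTOR, THE `SLaw`-SIDE GUARD-FREE CLAUSE AT A NO-EXPANSION `s′`, from row `rstep` alone.**
[cite: Balaban1988Convergent, (3.25) p.270, remark p.262, Theorem p.245, (2.17)–(2.18) p.257; Balaban1989LargeFieldI, (0.3) p.176] -/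
theorem sLaw₁₃_succ_clause_of_Omega_empty_of_liveSel_of_rstep
    (hrstep : ∀ (p : B12.RunParams) (k : ℕ) [DecidableEq (PBond (F.P p.K) (k + 1))], k < p.K →
      (towerRepOfRecord F N θ.ν θ.τ9 (slotsTOfRecord F N θ.ν θ.τ9 (EOfRecord₁₃ F N θ) (wOfRecord₉ F N θ.toStage9Params) θ.ppSel)
        θ.ppSel p (gOfRecord₁₃ F N θ p) (k + 1)).toRepData.ProvisosInt)
    (hsel : θ.ppSel = ppSelLiveOfRecord F N θ.ν θ.τ9 (EOfRecord₁₃ F N θ) (wOfRecord₉ F N θ.toStage9Params)) {k : ℕ} (hk : k < p.K) (hS : SLaw₁₃ F N θ p (k + 1))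
    (s : SeqOfRecord F θ.ν θ.τ9.M (gOfRecord₁₃ F N θ p) p.K (k + 1)) (hΩ : s.Ω (k + 1) = ∅) :
    ∃ (t : SeqOfRecord F θ.ν θ.τ9.M (gOfRecord₁₃ F N θ p) p.K (k + 1) → Sect2.TermValues (F.P p.K) (MatA N) (FluctV N) θ.τ9.M)
      (Ek : SeqOfRecord F θ.ν θ.τ9.M (gOfRecord₁₃ F N θ p) p.K (k + 1) → ℝ),
      Sect2.UniversalE t ∧
      (∀ s', Sect2.LawsRT (sect2TowerOfRecord F N (FluctV N) p.K (settingOfRecord₁₃ F N θ p) (θ.Rz p.K) s' (t s'))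
        (settingOfRecord₁₃ F N θ p).lf (k + 1)) ∧
      ((slotsTOfRecord F N θ.ν θ.τ9 (EOfRecord₁₃ F N θ) (wOfRecord₉ F N θ.toStage9Params) θ.ppSel p
          (gOfRecord₁₃ F N θ p) (k + 1) s =ᵐ[fieldMeasure (F.P p.K) (k + 1) (SU N)] 0) ∨
        ∀ᵐ V' ∂fieldMeasure (F.P p.K) (k + 1) (SU N),
          slotsTOfRecord F N θ.ν θ.τ9 (EOfRecord₁₃ F N θ) (wOfRecord₉ F N θ.toStage9Params) θ.ppSel p
              (gOfRecord₁₃ F N θ p) (k + 1) s V' =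
            sect2Slot F N (FluctV N) p.K (settingOfRecord₁₃ F N θ p) (θ.Rz p.K) (WtOfRecord₁₃ F N θ p) s (t s) (Ek s)
              (UbgOfRecord₁₃ F N θ p (k + 1) s) V') :=
  sLaw₁₃_succ_clause_of_Omega_empty_of_dead_of_rstep F N θ p hrstep hk (fun a hne V => dead_of_ppSel_succ_ne_of_liveSel F N θ hsel p k a hne V) hS s hΩ

/-- **★★ AT THE LIVE SELECTOR, `SLaw₁₃ θ p (k+1)` ⇒ the a.e. two-branch 𝐓-form of `slotT_{k+1}`, FROM K0b's `HasResidualsOfRecord` ALONE** — NO proviso field,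
NO admissibility, NO sign (the row `rstep` is `…LiveRstep.rstep₁₃_of_liveSel_of_hasResiduals`). [cite: Balaban1988Convergent, (2.17)–(2.18) p.257, Thm 1 p.262, (3.16) p.268, (3.24)–(3.25) p.270; Balaban1989LargeFieldI, (0.3)–(0.4) p.176, p.177 (i)–(ii)] -/
theorem slotsT_succ_aeForm_of_sLaw₁₃_succ_of_liveSel_of_hasResiduals (hres : θ.HasResidualsOfRecord F N)
    (hsel : θ.ppSel = ppSelLiveOfRecord F N θ.ν θ.τ9 (EOfRecord₁₃ F N θ) (wOfRecord₉ F N θ.toStage9Params)) (k : ℕ) (hk : k < p.K) (hS : SLaw₁₃ F N θ p (k + 1)) :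
    ∃ (t : SeqOfRecord F θ.ν θ.τ9.M (gOfRecord₁₃ F N θ p) p.K (k + 1) → Sect2.TermValues (F.P p.K) (MatA N) (FluctV N) θ.τ9.M)
      (Ek : SeqOfRecord F θ.ν θ.τ9.M (gOfRecord₁₃ F N θ p) p.K (k + 1) → ℝ), Sect2.UniversalE t ∧
      ∀ s, Sect2.LawsRT (sect2TowerOfRecord F N (FluctV N) p.K (settingOfRecord₁₃ F N θ p) (θ.Rz p.K) s (t s)) (settingOfRecord₁₃ F N θ p).lf (k + 1) ∧
        ((∀ᵐ V ∂(fieldMeasure (F.P p.K) (k + 1) (SU N)), chiSeqOfRecord F N θ.ν θ.τ9.M (gOfRecord₁₃ F N θ p) p.K (k + 1) s V ≠ 0 →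
            slotsTOfRecord F N θ.ν θ.τ9 (EOfRecord₁₃ F N θ) (wOfRecord₉ F N θ.toStage9Params) θ.ppSel p (gOfRecord₁₃ F N θ p) (k + 1) s V = 0) ∨
          ∀ᵐ V ∂(fieldMeasure (F.P p.K) (k + 1) (SU N)), chiSeqOfRecord F N θ.ν θ.τ9.M (gOfRecord₁₃ F N θ p) p.K (k + 1) s V ≠ 0 →
            slotsTOfRecord F N θ.ν θ.τ9 (EOfRecord₁₃ F N θ) (wOfRecord₉ F N θ.toStage9Params) θ.ppSel p (gOfRecord₁₃ F N θ p) (k + 1) s V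
              = sect2Slot F N (FluctV N) p.K (settingOfRecord₁₃ F N θ p) (θ.Rz p.K) (WtOfRecord₁₃ F N θ p) s (t s) (Ek s)
                  (UbgOfRecord₁₃ F N θ p (k + 1) s) V) :=
  slotsT_succ_aeForm_of_sLaw₁₃_succ_of_liveSel_of_rstep F N θ p (rstep₁₃_of_liveSel_of_hasResiduals hsel hres) hsel k hk hS

/-- **★★ AT THE LIVE SELECTOR, THE `SLaw`-SIDE GUARD-FREE CLAUSE AT A NO-EXPANSION `s′`, from `HasResidualsOfRecord` alone.**
[cite: Balaban1988Convergent, (3.25) p.270, remark p.262, Theorem p.245, (3.16) p.268; Balaban1989LargeFieldI, (0.3)–(0.4) p.176] -/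
theorem sLaw₁₃_succ_clause_of_Omega_empty_of_liveSel_of_hasResiduals (hres : θ.HasResidualsOfRecord F N)
    (hsel : θ.ppSel = ppSelLiveOfRecord F N θ.ν θ.τ9 (EOfRecord₁₃ F N θ) (wOfRecord₉ F N θ.toStage9Params)) {k : ℕ} (hk : k < p.K) (hS : SLaw₁₃ F N θ p (k + 1))
    (s : SeqOfRecord F θ.ν θ.τ9.M (gOfRecord₁₃ F N θ p) p.K (k + 1)) (hΩ : s.Ω (k + 1) = ∅) :
    ∃ (t : SeqOfRecord F θ.ν θ.τ9.M (gOfRecord₁₃ F N θ p) p.K (k + 1) → Sect2.TermValues (F.P p.K) (MatA N) (FluctV N) θ.τ9.M)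
      (Ek : SeqOfRecord F θ.ν θ.τ9.M (gOfRecord₁₃ F N θ p) p.K (k + 1) → ℝ),
      Sect2.UniversalE t ∧
      (∀ s', Sect2.LawsRT (sect2TowerOfRecord F N (FluctV N) p.K (settingOfRecord₁₃ F N θ p) (θ.Rz p.K) s' (t s'))
        (settingOfRecord₁₃ F N θ p).lf (k + 1)) ∧
      ((slotsTOfRecord F N θ.ν θ.τ9 (EOfRecord₁₃ F N θ) (wOfRecord₉ F N θ.toStage9Params) θ.ppSel p
          (gOfRecord₁₃ F N θ p) (k + 1) s =ᵐ[fieldMeasure (F.P p.K) (k + 1) (SU N)] 0) ∨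
        ∀ᵐ V' ∂fieldMeasure (F.P p.K) (k + 1) (SU N),
          slotsTOfRecord F N θ.ν θ.τ9 (EOfRecord₁₃ F N θ) (wOfRecord₉ F N θ.toStage9Params) θ.ppSel p
              (gOfRecord₁₃ F N θ p) (k + 1) s V' =
            sect2Slot F N (FluctV N) p.K (settingOfRecord₁₃ F N θ p) (θ.Rz p.K) (WtOfRecord₁₃ F N θ p) s (t s) (Ek s)
              (UbgOfRecord₁₃ F N θ p (k + 1) s) V') :=
  sLaw₁₃_succ_clause_of_Omega_empty_of_liveSel_of_rstep F N θ p (rstep₁₃_of_liveSel_of_hasResiduals hsel hres) hsel hk hS s hΩ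

end LiveSel

/-! ## §3  AT K0a's RE-PIN `θ.liveRepin₁₃` AND AT THE WITNESSES CARRYING K0b's RESIDUALS: the converse CLOSED but for `SLaw₁₃ … (k+1)` itself -/

section Repin

variable (θ : Stage13Params F N) (p : B12.RunParams)

/-- **★★ AT THE LIVE RE-PIN OF ANY PARAMETER CARRYING K0b's RESIDUALS: `SLaw₁₃ (k+1)` ⇒ the a.e. two-branch 𝐓-form of `slotT_{k+1}`** — from
`HasResidualsOfRecord θ` alone (the selector clause is `rfl`). [cite: Balaban1988Convergent, (2.17)–(2.18) p.257, Thm 1 p.262, (3.16) p.268, (3.24)–(3.25) p.270; Balaban1989LargeFieldI, (0.3)–(0.4) p.176, p.177 (i)–(ii)] -/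
theorem slotsT_succ_aeForm_of_sLaw₁₃_succ_liveRepin₁₃_of_hasResiduals (hres : θ.HasResidualsOfRecord F N) (k : ℕ) (hk : k < p.K)
    (hS : SLaw₁₃ F N (θ.liveRepin₁₃ F N) p (k + 1)) :
    ∃ (t : SeqOfRecord F (θ.liveRepin₁₃ F N).ν (θ.liveRepin₁₃ F N).τ9.M (gOfRecord₁₃ F N (θ.liveRepin₁₃ F N) p) p.K (k + 1) → Sect2.TermValues (F.P p.K) (MatA N) (FluctV N) (θ.liveRepin₁₃ F N).τ9.M)
      (Ek : SeqOfRecord F (θ.liveRepin₁₃ F N).ν (θ.liveRepin₁₃ F N).τ9.M (gOfRecord₁₃ F N (θ.liveRepin₁₃ F N) p) p.K (k + 1) → ℝ), Sect2.UniversalE t ∧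
      ∀ s, Sect2.LawsRT (sect2TowerOfRecord F N (FluctV N) p.K (settingOfRecord₁₃ F N (θ.liveRepin₁₃ F N) p) ((θ.liveRepin₁₃ F N).Rz p.K) s (t s)) (settingOfRecord₁₃ F N (θ.liveRepin₁₃ F N) p).lf (k + 1) ∧
        ((∀ᵐ V ∂(fieldMeasure (F.P p.K) (k + 1) (SU N)), chiSeqOfRecord F N (θ.liveRepin₁₃ F N).ν (θ.liveRepin₁₃ F N).τ9.M (gOfRecord₁₃ F N (θ.liveRepin₁₃ F N) p) p.K (k + 1) s V ≠ 0 →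
            slotsTOfRecord F N (θ.liveRepin₁₃ F N).ν (θ.liveRepin₁₃ F N).τ9 (EOfRecord₁₃ F N (θ.liveRepin₁₃ F N)) (wOfRecord₉ F N (θ.liveRepin₁₃ F N).toStage9Params) (θ.liveRepin₁₃ F N).ppSel p (gOfRecord₁₃ F N (θ.liveRepin₁₃ F N) p) (k + 1) s V = 0) ∨
          ∀ᵐ V ∂(fieldMeasure (F.P p.K) (k + 1) (SU N)), chiSeqOfRecord F N (θ.liveRepin₁₃ F N).ν (θ.liveRepin₁₃ F N).τ9.M (gOfRecord₁₃ F N (θ.liveRepin₁₃ F N) p) p.K (k + 1) s V ≠ 0 →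
            slotsTOfRecord F N (θ.liveRepin₁₃ F N).ν (θ.liveRepin₁₃ F N).τ9 (EOfRecord₁₃ F N (θ.liveRepin₁₃ F N)) (wOfRecord₉ F N (θ.liveRepin₁₃ F N).toStage9Params) (θ.liveRepin₁₃ F N).ppSel p (gOfRecord₁₃ F N (θ.liveRepin₁₃ F N) p) (k + 1) s V
              = sect2Slot F N (FluctV N) p.K (settingOfRecord₁₃ F N (θ.liveRepin₁₃ F N) p) ((θ.liveRepin₁₃ F N).Rz p.K) (WtOfRecord₁₃ F N (θ.liveRepin₁₃ F N) p) s (t s) (Ek s)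
                  (UbgOfRecord₁₃ F N (θ.liveRepin₁₃ F N) p (k + 1) s) V) :=
  slotsT_succ_aeForm_of_sLaw₁₃_succ_of_liveSel_of_hasResiduals F N (θ.liveRepin₁₃ F N) p (Stage13Params.HasResidualsOfRecord.liveRepin₁₃ hres)
    (liveRepin₁₃_liveSel F N θ) k hk hS

/-- **★★ THE `SLaw`-SIDE GUARD-FREE CLAUSE AT A NO-EXPANSION `s′` AT THE RE-PIN, from `HasResidualsOfRecord θ` alone.**
[cite: Balaban1988Convergent, (3.25) p.270, remark p.262, Theorem p.245, (3.16) p.268; Balaban1989LargeFieldI, (0.3)–(0.4) p.176] -/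
theorem sLaw₁₃_succ_clause_of_Omega_empty_liveRepin₁₃_of_hasResiduals (hres : θ.HasResidualsOfRecord F N) {k : ℕ} (hk : k < p.K)
    (hS : SLaw₁₃ F N (θ.liveRepin₁₃ F N) p (k + 1))
    (s : SeqOfRecord F (θ.liveRepin₁₃ F N).ν (θ.liveRepin₁₃ F N).τ9.M (gOfRecord₁₃ F N (θ.liveRepin₁₃ F N) p) p.K (k + 1)) (hΩ : s.Ω (k + 1) = ∅) :
    ∃ (t : SeqOfRecord F (θ.liveRepin₁₃ F N).ν (θ.liveRepin₁₃ F N).τ9.M (gOfRecord₁₃ F N (θ.liveRepin₁₃ F N) p) p.K (k + 1) → Sect2.TermValues (F.P p.K) (MatA N) (FluctV N) (θ.liveRepin₁₃ F N).τ9.M)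
      (Ek : SeqOfRecord F (θ.liveRepin₁₃ F N).ν (θ.liveRepin₁₃ F N).τ9.M (gOfRecord₁₃ F N (θ.liveRepin₁₃ F N) p) p.K (k + 1) → ℝ),
      Sect2.UniversalE t ∧
      (∀ s', Sect2.LawsRT (sect2TowerOfRecord F N (FluctV N) p.K (settingOfRecord₁₃ F N (θ.liveRepin₁₃ F N) p) ((θ.liveRepin₁₃ F N).Rz p.K) s' (t s'))
        (settingOfRecord₁₃ F N (θ.liveRepin₁₃ F N) p).lf (k + 1)) ∧
      ((slotsTOfRecord F N (θ.liveRepin₁₃ F N).ν (θ.liveRepin₁₃ F N).τ9 (EOfRecord₁₃ F N (θ.liveRepin₁₃ F N)) (wOfRecord₉ F N (θ.liveRepin₁₃ F N).toStage9Params) (θ.liveRepin₁₃ F N).ppSel p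
          (gOfRecord₁₃ F N (θ.liveRepin₁₃ F N) p) (k + 1) s =ᵐ[fieldMeasure (F.P p.K) (k + 1) (SU N)] 0) ∨
        ∀ᵐ V' ∂fieldMeasure (F.P p.K) (k + 1) (SU N),
          slotsTOfRecord F N (θ.liveRepin₁₃ F N).ν (θ.liveRepin₁₃ F N).τ9 (EOfRecord₁₃ F N (θ.liveRepin₁₃ F N)) (wOfRecord₉ F N (θ.liveRepin₁₃ F N).toStage9Params) (θ.liveRepin₁₃ F N).ppSel p
              (gOfRecord₁₃ F N (θ.liveRepin₁₃ F N) p) (k + 1) s V' =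
            sect2Slot F N (FluctV N) p.K (settingOfRecord₁₃ F N (θ.liveRepin₁₃ F N) p) ((θ.liveRepin₁₃ F N).Rz p.K) (WtOfRecord₁₃ F N (θ.liveRepin₁₃ F N) p) s (t s) (Ek s)
              (UbgOfRecord₁₃ F N (θ.liveRepin₁₃ F N) p (k + 1) s) V') :=
  sLaw₁₃_succ_clause_of_Omega_empty_of_liveSel_of_hasResiduals F N (θ.liveRepin₁₃ F N) p (Stage13Params.HasResidualsOfRecord.liveRepin₁₃ hres)
    (liveRepin₁₃_liveSel F N θ) hk hS s hΩ

end Repin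

section Numerics

variable {n : Stage12Numerics} {ε₂₉ : ℝ} (p : B12.RunParams)

/-- **★★ AT K0a's ALL-NUMERICS WITNESS `θ₁₃(n, ε₂₉)` (K0b's residuals): `SLaw₁₃ (k+1)` ⇒ the a.e. two-branch 𝐓-form of `slotT_{k+1}` — NO letter
hypothesis** (in particular at node00-def-K0a's [15]-keyed members `theta13OfThm1 …` ∕ `theta13OfThm1C …`, which ARE members by `rfl`).
[cite: Balaban1988Convergent, (2.17)–(2.18) p.257, Thm 1 p.262, (3.16) p.268, (3.24)–(3.25) p.270; Balaban1989LargeFieldI, (0.3)–(0.4) p.176, p.177 (i)–(ii)] -/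
theorem slotsT_succ_aeForm_of_sLaw₁₃_succ_theta13LiveOfNumerics (n : Stage12Numerics) (ε₂₉ : ℝ) (k : ℕ) (hk : k < p.K)
    (hS : SLaw₁₃ F N (theta13LiveOfNumerics F N n ε₂₉ (zeta316OfRecord F N n.ν n.τ9.M n.A₁) (RzOfRecord F N) (ZtOfRecord F N)) p (k + 1)) :
    ∃ (t : SeqOfRecord F (theta13LiveOfNumerics F N n ε₂₉ (zeta316OfRecord F N n.ν n.τ9.M n.A₁) (RzOfRecord F N) (ZtOfRecord F N)).ν (theta13LiveOfNumerics F N n ε₂₉ (zeta316OfRecord F N n.ν n.τ9.M n.A₁) (RzOfRecord F N) (ZtOfRecord F N)).τ9.M (gOfRecord₁₃ F N (theta13LiveOfNumerics F N n ε₂₉ (zeta316OfRecord F N n.ν n.τ9.M n.A₁) (RzOfRecord F N) (ZtOfRecord F N)) p) p.K (k + 1) → Sect2.TermValues (F.P p.K) (MatA N) (FluctV N) (theta13LiveOfNumerics F N n ε₂₉ (zeta316OfRecord F N n.ν n.τ9.M n.A₁) (RzOfRecord F N) (ZtOfRecord F N)).τ9.M)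
      (Ek : SeqOfRecord F (theta13LiveOfNumerics F N n ε₂₉ (zeta316OfRecord F N n.ν n.τ9.M n.A₁) (RzOfRecord F N) (ZtOfRecord F N)).ν (theta13LiveOfNumerics F N n ε₂₉ (zeta316OfRecord F N n.ν n.τ9.M n.A₁) (RzOfRecord F N) (ZtOfRecord F N)).τ9.M (gOfRecord₁₃ F N (theta13LiveOfNumerics F N n ε₂₉ (zeta316OfRecord F N n.ν n.τ9.M n.A₁) (RzOfRecord F N) (ZtOfRecord F N)) p) p.K (k + 1) → ℝ), Sect2.UniversalE t ∧
      ∀ s, Sect2.LawsRT (sect2TowerOfRecord F N (FluctV N) p.K (settingOfRecord₁₃ F N (theta13LiveOfNumerics F N n ε₂₉ (zeta316OfRecord F N n.ν n.τ9.M n.A₁) (RzOfRecord F N) (ZtOfRecord F N)) p) ((theta13LiveOfNumerics F N n ε₂₉ (zeta316OfRecord F N n.ν n.τ9.M n.A₁) (RzOfRecord F N) (ZtOfRecord F N)).Rz p.K) s (t s)) (settingOfRecord₁₃ F N (theta13LiveOfNumerics F N n ε₂₉ (zeta316OfRecord F N n.ν n.τ9.M n.A₁) (RzOfRecord F N) (ZtOfRecord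 F N)) p).lf (k + 1) ∧
        ((∀ᵐ V ∂(fieldMeasure (F.P p.K) (k + 1) (SU N)), chiSeqOfRecord F N (theta13LiveOfNumerics F N n ε₂₉ (zeta316OfRecord F N n.ν n.τ9.M n.A₁) (RzOfRecord F N) (ZtOfRecord F N)).ν (theta13LiveOfNumerics F N n ε₂₉ (zeta316OfRecord F N n.ν n.τ9.M n.A₁) (RzOfRecord F N) (ZtOfRecord F N)).τ9.M (gOfRecord₁₃ F N (theta13LiveOfNumerics F N n ε₂₉ (zeta316OfRecord F N n.ν n.τ9.M n.A₁) (RzOfRecord F N) (ZtOfRecord F N)) p) p.K (k + 1) s V ≠ 0 →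
            slotsTOfRecord F N (theta13LiveOfNumerics F N n ε₂₉ (zeta316OfRecord F N n.ν n.τ9.M n.A₁) (RzOfRecord F N) (ZtOfRecord F N)).ν (theta13LiveOfNumerics F N n ε₂₉ (zeta316OfRecord F N n.ν n.τ9.M n.A₁) (RzOfRecord F N) (ZtOfRecord F N)).τ9 (EOfRecord₁₃ F N (theta13LiveOfNumerics F N n ε₂₉ (zeta316OfRecord F N n.ν n.τ9.M n.A₁) (RzOfRecord F N) (ZtOfRecord F N))) (wOfRecord₉ F N (theta13LiveOfNumerics F N n ε₂₉ (zeta316OfRecord F N n.ν n.τ9.M n.A₁) (RzOfRecord F N) (ZtOfRecord F N)).toStage9Params) (theta13LiveOfNumerics F N n ε₂₉ (zeta316OfRecord F N n.ν n.τ9.M n.A₁) (RzOfRecord F N) (ZtOfRecord F N)).ppSel p (gOfRecord₁₃ F N (theta13LiveOfNumerics F N n ε₂₉ (zeta316OfRecord F N n.ν n.τ9.M n.A₁) (RzOfRecord F N) (ZtOfRecord F N)) p) (k + 1) s V = 0) ∨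
          ∀ᵐ V ∂(fieldMeasure (F.P p.K) (k + 1) (SU N)), chiSeqOfRecord F N (theta13LiveOfNumerics F N n ε₂₉ (zeta316OfRecord F N n.ν n.τ9.M n.A₁) (RzOfRecord F N) (ZtOfRecord F N)).ν (theta13LiveOfNumerics F N n ε₂₉ (zeta316OfRecord F N n.ν n.τ9.M n.A₁) (RzOfRecord F N) (ZtOfRecord F N)).τ9.M (gOfRecord₁₃ F N (theta13LiveOfNumerics F N n ε₂₉ (zeta316OfRecord F N n.ν n.τ9.M n.A₁) (RzOfRecord F N) (ZtOfRecord F N)) p) p.K (k + 1) s V ≠ 0 →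
            slotsTOfRecord F N (theta13LiveOfNumerics F N n ε₂₉ (zeta316OfRecord F N n.ν n.τ9.M n.A₁) (RzOfRecord F N) (ZtOfRecord F N)).ν (theta13LiveOfNumerics F N n ε₂₉ (zeta316OfRecord F N n.ν n.τ9.M n.A₁) (RzOfRecord F N) (ZtOfRecord F N)).τ9 (EOfRecord₁₃ F N (theta13LiveOfNumerics F N n ε₂₉ (zeta316OfRecord F N n.ν n.τ9.M n.A₁) (RzOfRecord F N) (ZtOfRecord F N))) (wOfRecord₉ F N (theta13LiveOfNumerics F N n ε₂₉ (zeta316OfRecord F N n.ν n.τ9.M n.A₁) (RzOfRecord F N) (ZtOfRecord F N)).toStage9Params) (theta13LiveOfNumerics F N n ε₂₉ (zeta316OfRecord F N n.ν n.τ9.M n.A₁) (RzOfRecord F N) (ZtOfRecord F N)).ppSel p (gOfRecord₁₃ F N (theta13LiveOfNumerics F N n ε₂₉ (zeta316OfRecord F N n.ν n.τ9.M n.A₁) (RzOfRecord F N) (ZtOfRecord F N)) p) (k + 1) s V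
              = sect2Slot F N (FluctV N) p.K (settingOfRecord₁₃ F N (theta13LiveOfNumerics F N n ε₂₉ (zeta316OfRecord F N n.ν n.τ9.M n.A₁) (RzOfRecord F N) (ZtOfRecord F N)) p) ((theta13LiveOfNumerics F N n ε₂₉ (zeta316OfRecord F N n.ν n.τ9.M n.A₁) (RzOfRecord F N) (ZtOfRecord F N)).Rz p.K) (WtOfRecord₁₃ F N (theta13LiveOfNumerics F N n ε₂₉ (zeta316OfRecord F N n.ν n.τ9.M n.A₁) (RzOfRecord F N) (ZtOfRecord F N)) p) s (t s) (Ek s)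
                  (UbgOfRecord₁₃ F N (theta13LiveOfNumerics F N n ε₂₉ (zeta316OfRecord F N n.ν n.τ9.M n.A₁) (RzOfRecord F N) (ZtOfRecord F N)) p (k + 1) s) V) :=
  slotsT_succ_aeForm_of_sLaw₁₃_succ_liveRepin₁₃_of_hasResiduals F N (theta13OfNumerics F N n ε₂₉ _ _ _) p
    (hasResidualsOfRecord_theta13OfNumerics F N n ε₂₉) k hk hS

/-- **★★ THE `SLaw`-SIDE GUARD-FREE CLAUSE AT A NO-EXPANSION `s′` AT `θ₁₃(n, ε₂₉)` — NO letter hypothesis.**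
[cite: Balaban1988Convergent, (3.25) p.270, remark p.262, Theorem p.245, (3.16) p.268; Balaban1989LargeFieldI, (0.3)–(0.4) p.176] -/
theorem sLaw₁₃_succ_clause_of_Omega_empty_theta13LiveOfNumerics (n : Stage12Numerics) (ε₂₉ : ℝ) {k : ℕ} (hk : k < p.K)
    (hS : SLaw₁₃ F N (theta13LiveOfNumerics F N n ε₂₉ (zeta316OfRecord F N n.ν n.τ9.M n.A₁) (RzOfRecord F N) (ZtOfRecord F N)) p (k + 1))
    (s : SeqOfRecord F (theta13LiveOfNumerics F N n ε₂₉ (zeta316OfRecord F N n.ν n.τ9.M n.A₁) (RzOfRecord F N) (ZtOfRecord F N)).ν (theta13LiveOfNumerics F N n ε₂₉ (zeta316OfRecord F N n.ν n.τ9.M n.A₁) (RzOfRecord F N) (ZtOfRecord F N)).τ9.M (gOfRecord₁₃ F N (theta13LiveOfNumerics F N n ε₂₉ (zeta316OfRecord F N n.ν n.τ9.M n.A₁) (RzOfRecord F N) (ZtOfRecord F N)) p) p.K (k + 1)) (hΩ : s.Ω (k + 1) = ∅) :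
    ∃ (t : SeqOfRecord F (theta13LiveOfNumerics F N n ε₂₉ (zeta316OfRecord F N n.ν n.τ9.M n.A₁) (RzOfRecord F N) (ZtOfRecord F N)).ν (theta13LiveOfNumerics F N n ε₂₉ (zeta316OfRecord F N n.ν n.τ9.M n.A₁) (RzOfRecord F N) (ZtOfRecord F N)).τ9.M (gOfRecord₁₃ F N (theta13LiveOfNumerics F N n ε₂₉ (zeta316OfRecord F N n.ν n.τ9.M n.A₁) (RzOfRecord F N) (ZtOfRecord F N)) p) p.K (k + 1) → Sect2.TermValues (F.P p.K) (MatA N) (FluctV N) (theta13LiveOfNumerics F N n ε₂₉ (zeta316OfRecord F N n.ν n.τ9.M n.A₁) (RzOfRecord F N) (ZtOfRecord F N)).τ9.M)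
      (Ek : SeqOfRecord F (theta13LiveOfNumerics F N n ε₂₉ (zeta316OfRecord F N n.ν n.τ9.M n.A₁) (RzOfRecord F N) (ZtOfRecord F N)).ν (theta13LiveOfNumerics F N n ε₂₉ (zeta316OfRecord F N n.ν n.τ9.M n.A₁) (RzOfRecord F N) (ZtOfRecord F N)).τ9.M (gOfRecord₁₃ F N (theta13LiveOfNumerics F N n ε₂₉ (zeta316OfRecord F N n.ν n.τ9.M n.A₁) (RzOfRecord F N) (ZtOfRecord F N)) p) p.K (k + 1) → ℝ),
      Sect2.UniversalE t ∧
      (∀ s', Sect2.LawsRT (sect2TowerOfRecord F N (FluctV N) p.K (settingOfRecord₁₃ F N (theta13LiveOfNumerics F N n ε₂₉ (zeta316OfRecord F N n.ν n.τ9.M n.A₁) (RzOfRecord F N) (ZtOfRecord F N)) p) ((theta13LiveOfNumerics F N n ε₂₉ (zeta316OfRecord F N n.ν n.τ9.M n.A₁) (RzOfRecord F N) (ZtOfRecord F N)).Rz p.K) s' (t s'))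
        (settingOfRecord₁₃ F N (theta13LiveOfNumerics F N n ε₂₉ (zeta316OfRecord F N n.ν n.τ9.M n.A₁) (RzOfRecord F N) (ZtOfRecord F N)) p).lf (k + 1)) ∧
      ((slotsTOfRecord F N (theta13LiveOfNumerics F N n ε₂₉ (zeta316OfRecord F N n.ν n.τ9.M n.A₁) (RzOfRecord F N) (ZtOfRecord F N)).ν (theta13LiveOfNumerics F N n ε₂₉ (zeta316OfRecord F N n.ν n.τ9.M n.A₁) (RzOfRecord F N) (ZtOfRecord F N)).τ9 (EOfRecord₁₃ F N (theta13LiveOfNumerics F N n ε₂₉ (zeta316OfRecord F N n.ν n.τ9.M n.A₁) (RzOfRecord F N) (ZtOfRecord F N))) (wOfRecord₉ F N (theta13LiveOfNumerics F N n ε₂₉ (zeta316OfRecord F N n.ν n.τ9.M n.A₁) (RzOfRecord F N) (ZtOfRecord F N)).toStage9Params) (theta13LiveOfNumerics F N n ε₂₉ (zeta316OfRecord F N n.ν n.τ9.M n.A₁) (RzOfRecord F N) (ZtOfRecord F N)).ppSel p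
          (gOfRecord₁₃ F N (theta13LiveOfNumerics F N n ε₂₉ (zeta316OfRecord F N n.ν n.τ9.M n.A₁) (RzOfRecord F N) (ZtOfRecord F N)) p) (k + 1) s =ᵐ[fieldMeasure (F.P p.K) (k + 1) (SU N)] 0) ∨
        ∀ᵐ V' ∂fieldMeasure (F.P p.K) (k + 1) (SU N),
          slotsTOfRecord F N (theta13LiveOfNumerics F N n ε₂₉ (zeta316OfRecord F N n.ν n.τ9.M n.A₁) (RzOfRecord F N) (ZtOfRecord F N)).ν (theta13LiveOfNumerics F N n ε₂₉ (zeta316OfRecord F N n.ν n.τ9.M n.A₁) (RzOfRecord F N) (ZtOfRecord F N)).τ9 (EOfRecord₁₃ F N (theta13LiveOfNumerics F N n ε₂₉ (zeta316OfRecord F N n.ν n.τ9.M n.A₁) (RzOfRecord F N) (ZtOfRecord F N))) (wOfRecord₉ F N (theta13LiveOfNumerics F N n ε₂₉ (zeta316OfRecord F N n.ν n.τ9.M n.A₁) (RzOfRecord F N) (ZtOfRecord F N)).toStage9Params) (theta13LiveOfNumerics F N n ε₂₉ (zeta316OfRecord F N n.ν n.τ9.M n.A₁) (RzOfRecord F N)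 (ZtOfRecord F N)).ppSel p
              (gOfRecord₁₃ F N (theta13LiveOfNumerics F N n ε₂₉ (zeta316OfRecord F N n.ν n.τ9.M n.A₁) (RzOfRecord F N) (ZtOfRecord F N)) p) (k + 1) s V' =
            sect2Slot F N (FluctV N) p.K (settingOfRecord₁₃ F N (theta13LiveOfNumerics F N n ε₂₉ (zeta316OfRecord F N n.ν n.τ9.M n.A₁) (RzOfRecord F N) (ZtOfRecord F N)) p) ((theta13LiveOfNumerics F N n ε₂₉ (zeta316OfRecord F N n.ν n.τ9.M n.A₁) (RzOfRecord F N) (ZtOfRecord F N)).Rz p.K) (WtOfRecord₁₃ F N (theta13LiveOfNumerics F N n ε₂₉ (zeta316OfRecord F N n.ν n.τ9.M n.A₁) (RzOfRecord F N) (ZtOfRecord F N)) p) s (t s) (Ek s)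
              (UbgOfRecord₁₃ F N (theta13LiveOfNumerics F N n ε₂₉ (zeta316OfRecord F N n.ν n.τ9.M n.A₁) (RzOfRecord F N) (ZtOfRecord F N)) p (k + 1) s) V') :=
  sLaw₁₃_succ_clause_of_Omega_empty_liveRepin₁₃_of_hasResiduals F N (theta13OfNumerics F N n ε₂₉ _ _ _) p
    (hasResidualsOfRecord_theta13OfNumerics F N n ε₂₉) hk hS s hΩ

end Numerics

section Thm1CWitness

variable {ε₀ ε₂₉ B₃ a₀ a₁ : ℝ} (p : B12.RunParams)

/-- **★★ AT node00-def-K0a's `L`-KEYED [15]-KEYED WITNESS `θ₁₅ᶜ = theta13OfThm1C F N ε₀ ε₂₉ B₃ a₀ a₁` (K0⁗'s explicit witness family): `SLaw₁₃ (k+1)` ⇒ the a.e.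
two-branch 𝐓-form of `slotT_{k+1}` — NO letter hypothesis, NO [15] fact, NO `bg`.** [cite: Balaban1988Convergent, (2.17)–(2.18) p.257, Thm 1 p.262, (3.16) p.268, (3.24)–(3.25) p.270; Balaban1989LargeFieldI, (0.3)–(0.4) p.176, p.177 (i)–(ii); Balaban1985Variational, Thm 1 p.279 (witness letters only)] -/
theorem slotsT_succ_aeForm_of_sLaw₁₃_succ_theta13OfThm1C (ε₀ ε₂₉ B₃ a₀ a₁ : ℝ) (k : ℕ) (hk : k < p.K)
    (hS : SLaw₁₃ F N (theta13OfThm1C F N ε₀ ε₂₉ B₃ a₀ a₁) p (k + 1)) :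
    ∃ (t : SeqOfRecord F (theta13OfThm1C F N ε₀ ε₂₉ B₃ a₀ a₁).ν (theta13OfThm1C F N ε₀ ε₂₉ B₃ a₀ a₁).τ9.M (gOfRecord₁₃ F N (theta13OfThm1C F N ε₀ ε₂₉ B₃ a₀ a₁) p) p.K (k + 1) → Sect2.TermValues (F.P p.K) (MatA N) (FluctV N) (theta13OfThm1C F N ε₀ ε₂₉ B₃ a₀ a₁).τ9.M)
      (Ek : SeqOfRecord F (theta13OfThm1C F N ε₀ ε₂₉ B₃ a₀ a₁).ν (theta13OfThm1C F N ε₀ ε₂₉ B₃ a₀ a₁).τ9.M (gOfRecord₁₃ F N (theta13OfThm1C F N ε₀ ε₂₉ B₃ a₀ a₁) p) p.K (k + 1) → ℝ), Sect2.UniversalE t ∧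
      ∀ s, Sect2.LawsRT (sect2TowerOfRecord F N (FluctV N) p.K (settingOfRecord₁₃ F N (theta13OfThm1C F N ε₀ ε₂₉ B₃ a₀ a₁) p) ((theta13OfThm1C F N ε₀ ε₂₉ B₃ a₀ a₁).Rz p.K) s (t s)) (settingOfRecord₁₃ F N (theta13OfThm1C F N ε₀ ε₂₉ B₃ a₀ a₁) p).lf (k + 1) ∧
        ((∀ᵐ V ∂(fieldMeasure (F.P p.K) (k + 1) (SU N)), chiSeqOfRecord F N (theta13OfThm1C F N ε₀ ε₂₉ B₃ a₀ a₁).ν (theta13OfThm1C F N ε₀ ε₂₉ B₃ a₀ a₁).τ9.M (gOfRecord₁₃ F N (theta13OfThm1C F N ε₀ ε₂₉ B₃ a₀ a₁) p) p.K (k + 1) s V ≠ 0 →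
            slotsTOfRecord F N (theta13OfThm1C F N ε₀ ε₂₉ B₃ a₀ a₁).ν (theta13OfThm1C F N ε₀ ε₂₉ B₃ a₀ a₁).τ9 (EOfRecord₁₃ F N (theta13OfThm1C F N ε₀ ε₂₉ B₃ a₀ a₁)) (wOfRecord₉ F N (theta13OfThm1C F N ε₀ ε₂₉ B₃ a₀ a₁).toStage9Params) (theta13OfThm1C F N ε₀ ε₂₉ B₃ a₀ a₁).ppSel p (gOfRecord₁₃ F N (theta13OfThm1C F N ε₀ ε₂₉ B₃ a₀ a₁) p) (k + 1) s V = 0) ∨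
          ∀ᵐ V ∂(fieldMeasure (F.P p.K) (k + 1) (SU N)), chiSeqOfRecord F N (theta13OfThm1C F N ε₀ ε₂₉ B₃ a₀ a₁).ν (theta13OfThm1C F N ε₀ ε₂₉ B₃ a₀ a₁).τ9.M (gOfRecord₁₃ F N (theta13OfThm1C F N ε₀ ε₂₉ B₃ a₀ a₁) p) p.K (k + 1) s V ≠ 0 →
            slotsTOfRecord F N (theta13OfThm1C F N ε₀ ε₂₉ B₃ a₀ a₁).ν (theta13OfThm1C F N ε₀ ε₂₉ B₃ a₀ a₁).τ9 (EOfRecord₁₃ F N (theta13OfThm1C F N ε₀ ε₂₉ B₃ a₀ a₁)) (wOfRecord₉ F N (theta13OfThm1C F N ε₀ ε₂₉ B₃ a₀ a₁).toStage9Params) (theta13OfThm1C F N ε₀ ε₂₉ B₃ a₀ a₁).ppSel p (gOfRecord₁₃ F N (theta13OfThm1C F N ε₀ ε₂₉ B₃ a₀ a₁) p) (k + 1) s V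
              = sect2Slot F N (FluctV N) p.K (settingOfRecord₁₃ F N (theta13OfThm1C F N ε₀ ε₂₉ B₃ a₀ a₁) p) ((theta13OfThm1C F N ε₀ ε₂₉ B₃ a₀ a₁).Rz p.K) (WtOfRecord₁₃ F N (theta13OfThm1C F N ε₀ ε₂₉ B₃ a₀ a₁) p) s (t s) (Ek s)
                  (UbgOfRecord₁₃ F N (theta13OfThm1C F N ε₀ ε₂₉ B₃ a₀ a₁) p (k + 1) s) V) :=
  slotsT_succ_aeForm_of_sLaw₁₃_succ_theta13LiveOfNumerics F N p (stage12NumericsOfThm1C F.L ε₀ B₃ a₀ a₁) ε₂₉ k hk hS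

/-- **★★ THE `SLaw`-SIDE GUARD-FREE CLAUSE AT A NO-EXPANSION `s′` AT `θ₁₅ᶜ` — NO letter hypothesis.**
[cite: Balaban1988Convergent, (3.25) p.270, remark p.262, Theorem p.245, (3.16) p.268; Balaban1989LargeFieldI, (0.3)–(0.4) p.176] -/
theorem sLaw₁₃_succ_clause_of_Omega_empty_theta13OfThm1C (ε₀ ε₂₉ B₃ a₀ a₁ : ℝ) {k : ℕ} (hk : k < p.K)
    (hS : SLaw₁₃ F N (theta13OfThm1C F N ε₀ ε₂₉ B₃ a₀ a₁) p (k + 1))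
    (s : SeqOfRecord F (theta13OfThm1C F N ε₀ ε₂₉ B₃ a₀ a₁).ν (theta13OfThm1C F N ε₀ ε₂₉ B₃ a₀ a₁).τ9.M (gOfRecord₁₃ F N (theta13OfThm1C F N ε₀ ε₂₉ B₃ a₀ a₁) p) p.K (k + 1)) (hΩ : s.Ω (k + 1) = ∅) :
    ∃ (t : SeqOfRecord F (theta13OfThm1C F N ε₀ ε₂₉ B₃ a₀ a₁).ν (theta13OfThm1C F N ε₀ ε₂₉ B₃ a₀ a₁).τ9.M (gOfRecord₁₃ F N (theta13OfThm1C F N ε₀ ε₂₉ B₃ a₀ a₁) p) p.K (k + 1) → Sect2.TermValues (F.P p.K) (MatA N) (FluctV N) (theta13OfThm1C F N ε₀ ε₂₉ B₃ a₀ a₁).τ9.M)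
      (Ek : SeqOfRecord F (theta13OfThm1C F N ε₀ ε₂₉ B₃ a₀ a₁).ν (theta13OfThm1C F N ε₀ ε₂₉ B₃ a₀ a₁).τ9.M (gOfRecord₁₃ F N (theta13OfThm1C F N ε₀ ε₂₉ B₃ a₀ a₁) p) p.K (k + 1) → ℝ),
      Sect2.UniversalE t ∧
      (∀ s', Sect2.LawsRT (sect2TowerOfRecord F N (FluctV N) p.K (settingOfRecord₁₃ F N (theta13OfThm1C F N ε₀ ε₂₉ B₃ a₀ a₁) p) ((theta13OfThm1C F N ε₀ ε₂₉ B₃ a₀ a₁).Rz p.K) s' (t s'))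
        (settingOfRecord₁₃ F N (theta13OfThm1C F N ε₀ ε₂₉ B₃ a₀ a₁) p).lf (k + 1)) ∧
      ((slotsTOfRecord F N (theta13OfThm1C F N ε₀ ε₂₉ B₃ a₀ a₁).ν (theta13OfThm1C F N ε₀ ε₂₉ B₃ a₀ a₁).τ9 (EOfRecord₁₃ F N (theta13OfThm1C F N ε₀ ε₂₉ B₃ a₀ a₁)) (wOfRecord₉ F N (theta13OfThm1C F N ε₀ ε₂₉ B₃ a₀ a₁).toStage9Params) (theta13OfThm1C F N ε₀ ε₂₉ B₃ a₀ a₁).ppSel p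
          (gOfRecord₁₃ F N (theta13OfThm1C F N ε₀ ε₂₉ B₃ a₀ a₁) p) (k + 1) s =ᵐ[fieldMeasure (F.P p.K) (k + 1) (SU N)] 0) ∨
        ∀ᵐ V' ∂fieldMeasure (F.P p.K) (k + 1) (SU N),
          slotsTOfRecord F N (theta13OfThm1C F N ε₀ ε₂₉ B₃ a₀ a₁).ν (theta13OfThm1C F N ε₀ ε₂₉ B₃ a₀ a₁).τ9 (EOfRecord₁₃ F N (theta13OfThm1C F N ε₀ ε₂₉ B₃ a₀ a₁)) (wOfRecord₉ F N (theta13OfThm1C F N ε₀ ε₂₉ B₃ a₀ a₁).toStage9Params) (theta13OfThm1C F N ε₀ ε₂₉ B₃ a₀ a₁).ppSel p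
              (gOfRecord₁₃ F N (theta13OfThm1C F N ε₀ ε₂₉ B₃ a₀ a₁) p) (k + 1) s V' =
            sect2Slot F N (FluctV N) p.K (settingOfRecord₁₃ F N (theta13OfThm1C F N ε₀ ε₂₉ B₃ a₀ a₁) p) ((theta13OfThm1C F N ε₀ ε₂₉ B₃ a₀ a₁).Rz p.K) (WtOfRecord₁₃ F N (theta13OfThm1C F N ε₀ ε₂₉ B₃ a₀ a₁) p) s (t s) (Ek s)
              (UbgOfRecord₁₃ F N (theta13OfThm1C F N ε₀ ε₂₉ B₃ a₀ a₁) p (k + 1) s) V') :=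
  sLaw₁₃_succ_clause_of_Omega_empty_theta13LiveOfNumerics F N p (stage12NumericsOfThm1C F.L ε₀ B₃ a₀ a₁) ε₂₉ hk hS s hΩ

end Thm1CWitness

section OfRecord

variable (p : B12.RunParams)

/-- **★★★ AT THE STAGE-13 WITNESS OF RECORD `θ₁₃ = theta13LiveOfRecord F N`: `SLaw₁₃ θ₁₃ p (k+1)` ⇒ the a.e. two-branch 𝐓-form of `slotT_{k+1}` — ZERO
further hypotheses** (`k < K`).  On the K0‴ witness line the §2 form of `ρ_{k+1}` — N11's node conclusion read at the record — already carries, sequence by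
sequence, the a.e. content of [III]'s (3.25) identity for `𝐓ρ_k`'s slot family: 𝐑 of record cannot supply it. [cite: Balaban1988Convergent, (2.17)–(2.18) p.257, Thm 1 p.262, (3.16) p.268, (3.22) p.269, (3.24)–(3.25) p.270; Balaban1989LargeFieldI, (0.3)–(0.4) p.176, p.177 (i)–(ii)] -/
theorem slotsT_succ_aeForm_of_sLaw₁₃_succ_theta13LiveOfRecord (k : ℕ) (hk : k < p.K)
    (hS : SLaw₁₃ F N (theta13LiveOfRecord F N) p (k + 1)) :
    ∃ (t : SeqOfRecord F (theta13LiveOfRecord F N).ν (theta13LiveOfRecord F N).τ9.M (gOfRecord₁₃ F N (theta13LiveOfRecord F N) p) p.K (k + 1) → Sect2.TermValues (F.P p.K) (MatA N) (FluctV N) (theta13LiveOfRecord F N).τ9.M)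
      (Ek : SeqOfRecord F (theta13LiveOfRecord F N).ν (theta13LiveOfRecord F N).τ9.M (gOfRecord₁₃ F N (theta13LiveOfRecord F N) p) p.K (k + 1) → ℝ), Sect2.UniversalE t ∧
      ∀ s, Sect2.LawsRT (sect2TowerOfRecord F N (FluctV N) p.K (settingOfRecord₁₃ F N (theta13LiveOfRecord F N) p) ((theta13LiveOfRecord F N).Rz p.K) s (t s)) (settingOfRecord₁₃ F N (theta13LiveOfRecord F N) p).lf (k + 1) ∧
        ((∀ᵐ V ∂(fieldMeasure (F.P p.K) (k + 1) (SU N)), chiSeqOfRecord F N (theta13LiveOfRecord F N).ν (theta13LiveOfRecord F N).τ9.M (gOfRecord₁₃ F N (theta13LiveOfRecord F N) p) p.K (k + 1) s V ≠ 0 →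
            slotsTOfRecord F N (theta13LiveOfRecord F N).ν (theta13LiveOfRecord F N).τ9 (EOfRecord₁₃ F N (theta13LiveOfRecord F N)) (wOfRecord₉ F N (theta13LiveOfRecord F N).toStage9Params) (theta13LiveOfRecord F N).ppSel p (gOfRecord₁₃ F N (theta13LiveOfRecord F N) p) (k + 1) s V = 0) ∨
          ∀ᵐ V ∂(fieldMeasure (F.P p.K) (k + 1) (SU N)), chiSeqOfRecord F N (theta13LiveOfRecord F N).ν (theta13LiveOfRecord F N).τ9.M (gOfRecord₁₃ F N (theta13LiveOfRecord F N) p) p.K (k + 1) s V ≠ 0 →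
            slotsTOfRecord F N (theta13LiveOfRecord F N).ν (theta13LiveOfRecord F N).τ9 (EOfRecord₁₃ F N (theta13LiveOfRecord F N)) (wOfRecord₉ F N (theta13LiveOfRecord F N).toStage9Params) (theta13LiveOfRecord F N).ppSel p (gOfRecord₁₃ F N (theta13LiveOfRecord F N) p) (k + 1) s V
              = sect2Slot F N (FluctV N) p.K (settingOfRecord₁₃ F N (theta13LiveOfRecord F N) p) ((theta13LiveOfRecord F N).Rz p.K) (WtOfRecord₁₃ F N (theta13LiveOfRecord F N) p) s (t s) (Ek s)
                  (UbgOfRecord₁₃ F N (theta13LiveOfRecord F N) p (k + 1) s) V) :=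
  slotsT_succ_aeForm_of_sLaw₁₃_succ_liveRepin₁₃_of_hasResiduals F N (theta13OfFamily F N eps0OfRecord₁₃ _ _ _) p
    (hasResidualsOfRecord_theta13OfFamily F N eps0OfRecord₁₃) k hk hS

/-- **★★★ THE `SLaw`-SIDE GUARD-FREE CLAUSE AT A NO-EXPANSION `s′` AT THE WITNESS OF RECORD — ZERO further hypotheses**: if `ρ_{k+1}` of record has the §2 form
(`SLaw₁₃ θ₁₃ p (k+1)`), then at every new sequence `s′` with `Ω_{k+1}(s′) = ∅` EITHER def-T's pre-𝐑 slot `slotT_{k+1}(s′)` vanishes `dV′`-a.e. OR it equals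
`𝐓_{k+1}(s′) exp A_{k+1}(s′)` `dV′`-a.e. — at `k = 0` exactly the input of seat dag-n11-d's rough-fibre ∕ Haar-null necessary conditions (their
`Thm/BalabanUVNodesN11NoExpansionRoughFibre` §2, a.e. left branch tolerated), now sourced from `SLaw₁₃ θ₁₃ p 1` instead of `TLaw₁₃ θ₁₃ p 0`.
[cite: Balaban1988Convergent, (3.25) p.270, remark p.262, Theorem p.245, Thm 1 p.262, (3.16) p.268; Balaban1989LargeFieldI, (0.3)–(0.4) p.176] -/
theorem sLaw₁₃_succ_clause_of_Omega_empty_theta13LiveOfRecord {k : ℕ} (hk : k < p.K)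
    (hS : SLaw₁₃ F N (theta13LiveOfRecord F N) p (k + 1))
    (s : SeqOfRecord F (theta13LiveOfRecord F N).ν (theta13LiveOfRecord F N).τ9.M (gOfRecord₁₃ F N (theta13LiveOfRecord F N) p) p.K (k + 1)) (hΩ : s.Ω (k + 1) = ∅) :
    ∃ (t : SeqOfRecord F (theta13LiveOfRecord F N).ν (theta13LiveOfRecord F N).τ9.M (gOfRecord₁₃ F N (theta13LiveOfRecord F N) p) p.K (k + 1) → Sect2.TermValues (F.P p.K) (MatA N) (FluctV N) (theta13LiveOfRecord F N).τ9.M)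
      (Ek : SeqOfRecord F (theta13LiveOfRecord F N).ν (theta13LiveOfRecord F N).τ9.M (gOfRecord₁₃ F N (theta13LiveOfRecord F N) p) p.K (k + 1) → ℝ),
      Sect2.UniversalE t ∧
      (∀ s', Sect2.LawsRT (sect2TowerOfRecord F N (FluctV N) p.K (settingOfRecord₁₃ F N (theta13LiveOfRecord F N) p) ((theta13LiveOfRecord F N).Rz p.K) s' (t s'))
        (settingOfRecord₁₃ F N (theta13LiveOfRecord F N) p).lf (k + 1)) ∧
      ((slotsTOfRecord F N (theta13LiveOfRecord F N).ν (theta13LiveOfRecord F N).τ9 (EOfRecord₁₃ F N (theta13LiveOfRecord F N)) (wOfRecord₉ F N (theta13LiveOfRecord F N).toStage9Params) (theta13LiveOfRecord F N).ppSel p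
          (gOfRecord₁₃ F N (theta13LiveOfRecord F N) p) (k + 1) s =ᵐ[fieldMeasure (F.P p.K) (k + 1) (SU N)] 0) ∨
        ∀ᵐ V' ∂fieldMeasure (F.P p.K) (k + 1) (SU N),
          slotsTOfRecord F N (theta13LiveOfRecord F N).ν (theta13LiveOfRecord F N).τ9 (EOfRecord₁₃ F N (theta13LiveOfRecord F N)) (wOfRecord₉ F N (theta13LiveOfRecord F N).toStage9Params) (theta13LiveOfRecord F N).ppSel p
              (gOfRecord₁₃ F N (theta13LiveOfRecord F N) p) (k + 1) s V' =
            sect2Slot F N (FluctV N) p.K (settingOfRecord₁₃ F N (theta13LiveOfRecord F N) p) ((theta13LiveOfRecord F N).Rz p.K) (WtOfRecord₁₃ F N (theta13LiveOfRecord F N) p) s (t s) (Ek s)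
              (UbgOfRecord₁₃ F N (theta13LiveOfRecord F N) p (k + 1) s) V') :=
  sLaw₁₃_succ_clause_of_Omega_empty_liveRepin₁₃_of_hasResiduals F N (theta13OfFamily F N eps0OfRecord₁₃ _ _ _) p
    (hasResidualsOfRecord_theta13OfFamily F N eps0OfRecord₁₃) hk hS s hΩ

end OfRecord

/-! ## §4  THE NODE-CONJUNCT FACES: N11's conclusion `densitiesDescribed` at a world bound to a Stage-13 C-binding IS `∀ k ≤ K, SLaw₁₃ θ P k`; what a
non-vacuous `Dag.B14_main (leavesP w P)` therefore carries on the live line -/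

section NodeFaces

variable (θ : Stage13Params F N) (p : B12.RunParams) (w : WorldP)

/-- **N11's CONCLUSION AT A WORLD BOUND TO THE STAGE-13 C-BINDING IS `∀ k ≤ K, SLaw₁₃ θ p k`** — PROVISO-FREE form: the construction of record
`(coreOfRecord₁₃ θ).construction (densOfRecord₁₃ θ)` is what `datumOfRecord₁₃Sep F N θ h` carries as `C` for EVERY `h` (`Node00.datumOfRecord₁₃Sep_C`, `rfl`), and the
core's §2 clause IS `SLaw₁₃` (`Node00.sect2Form_coreOfRecord₁₃_iff`, `Iff.rfl`). [cite: Balaban1988Convergent, Thm 1 p.262, (2.18) p.257 (bookkeeping at the record)] -/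
theorem densitiesDescribed_leavesP_iff_sLaw₁₃_all (hC : w.C = (coreOfRecord₁₃ F N θ).construction (densOfRecord₁₃ F N θ)) :
    (leavesP w p).densitiesDescribed ↔ ∀ k, k ≤ p.K → SLaw₁₃ F N θ p k := by
  show (∀ k, k ≤ p.K → (w.C p).Sect2Form k) ↔ _
  rw [hC]
  exact Iff.rfl

variable (h : θ.Provisos₁₃Sep F N)

/-- **… the same keyed on the v1.2 datum `datumOfRecord₁₃Sep F N θ h`** (the binder shape of the ⁗ knits). [cite: Balaban1988Convergent, Thm 1 p.262, (2.18) p.257 (bookkeeping at the record)] -/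
theorem densitiesDescribed_leavesP_iff_sLaw₁₃_all_sep (hC : w.C = (datumOfRecord₁₃Sep F N θ h).C) :
    (leavesP w p).densitiesDescribed ↔ ∀ k, k ≤ p.K → SLaw₁₃ F N θ p k :=
  densitiesDescribed_leavesP_iff_sLaw₁₃_all F N θ p w (by rw [hC]; rfl)

/-- **WHAT A NON-VACUOUS `Dag.B14_main (leavesP w P)` CARRIES AT A STAGE-13 RECORD**: with the node's in-edge leaves `b7 … b11`, the small-field implication,
the flow control, the run's `rOperation` antecedent and the interval hypothesis `smallCouplings` all read TRUE, N11's node statement IS `∀ k ≤ K, SLaw₁₃ θ P k`.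
Pure logic at the binding. [cite: Balaban1988Convergent, Thm 1 p.262, Theorem p.245, p.244 (bookkeeping at the record)] -/
theorem sLaw₁₃_all_of_b14_main_leavesP (hC : w.C = (datumOfRecord₁₃Sep F N θ h).C) (h14 : Dag.B14_main (leavesP w p))
    (h7 : (leavesP w p).b7) (h8 : (leavesP w p).b8) (h9 : (leavesP w p).b9) (h10 : (leavesP w p).b10) (h11 : (leavesP w p).b11)
    (hsf : (leavesP w p).smallCouplings → (leavesP w p).smallFieldInductive) (hfc : (leavesP w p).smallCouplings → (leavesP w p).flowControl)
    (hrop : (leavesP w p).rOperation) (hsc : (leavesP w p).smallCouplings) :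
    ∀ k, k ≤ p.K → SLaw₁₃ F N θ p k :=
  (densitiesDescribed_leavesP_iff_sLaw₁₃_all_sep F N θ p w h hC).1 (h14 h7 h8 h9 h10 h11 hsf hfc hrop hsc)

/-- **… AT THE LIVE SELECTOR the `rOperation` antecedent is `…LiveRstep`'s theorem** (from `HasResidualsOfRecord`, admissibility and the three term-constant signs), so a
non-vacuous N11 conjunct there IS `∀ k ≤ K, SLaw₁₃ θ P k` given the other leaves. [cite: Balaban1988Convergent, Thm 1 p.262, Theorem p.245, p.244; Balaban1989LargeFieldI, (0.3)–(0.4) p.176 (bookkeeping at the record)] -/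
theorem sLaw₁₃_all_of_b14_main_leavesP_of_liveSel (hC : w.C = (datumOfRecord₁₃Sep F N θ h).C) (hup : w.up p = upOfRecord₅C F N (θ.toStage5₁₃ F N) p)
    (hres : θ.HasResidualsOfRecord F N) (hθ : θ.Admissible F N) (hκ : 0 ≤ θ.s2.lf.κ) (hE₀ : 0 ≤ θ.s2.lf.E₀) (hB₀ : 0 ≤ θ.s2.lf.B₀)
    (hsel : θ.ppSel = ppSelLiveOfRecord F N θ.ν θ.τ9 (EOfRecord₁₃ F N θ) (wOfRecord₉ F N θ.toStage9Params))
    (h14 : Dag.B14_main (leavesP w p))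
    (h7 : (leavesP w p).b7) (h8 : (leavesP w p).b8) (h9 : (leavesP w p).b9) (h10 : (leavesP w p).b10) (h11 : (leavesP w p).b11)
    (hsf : (leavesP w p).smallCouplings → (leavesP w p).smallFieldInductive) (hfc : (leavesP w p).smallCouplings → (leavesP w p).flowControl)
    (hsc : (leavesP w p).smallCouplings) :
    ∀ k, k ≤ p.K → SLaw₁₃ F N θ p k :=
  sLaw₁₃_all_of_b14_main_leavesP F N θ p w h hC h14 h7 h8 h9 h10 h11 hsf hfc
    (rOperation_leavesP_of_liveSel₁₃_of_hasResiduals F N θ p w hup hres hθ hκ hE₀ hB₀ hsel) hsc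

/-- **★★ THE NODE CONCLUSION ON THE LIVE LINE CARRIES THE `SLaw`-SIDE CLAUSE AT EVERY NO-EXPANSION SEQUENCE OF EVERY LEVEL** (`k < K`): at a world bound to the
v1.2 datum of a `θ` at the live selector carrying K0b's residuals, `densitiesDescribed (leavesP w p)` ⇒ for every `s′` with `Ω_{k+1}(s′) = ∅` the guard-free
clause «`slotT_{k+1}(s′) =ᵐ 0 ∨ slotT_{k+1}(s′) =ᵐ 𝐓_{k+1}(s′) exp A_{k+1}(s′)`». [cite: Balaban1988Convergent, Thm 1 p.262, (3.25) p.270, Theorem p.245, (3.16) p.268; Balaban1989LargeFieldI, (0.3)–(0.4) p.176] -/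
theorem sLaw₁₃_succ_clause_of_Omega_empty_of_densitiesDescribed_of_liveSel (hC : w.C = (datumOfRecord₁₃Sep F N θ h).C)
    (hres : θ.HasResidualsOfRecord F N)
    (hsel : θ.ppSel = ppSelLiveOfRecord F N θ.ν θ.τ9 (EOfRecord₁₃ F N θ) (wOfRecord₉ F N θ.toStage9Params))
    (hD : (leavesP w p).densitiesDescribed) {k : ℕ} (hk : k < p.K)
    (s : SeqOfRecord F θ.ν θ.τ9.M (gOfRecord₁₃ F N θ p) p.K (k + 1)) (hΩ : s.Ω (k + 1) = ∅) :
    ∃ (t : SeqOfRecord F θ.ν θ.τ9.M (gOfRecord₁₃ F N θ p) p.K (k + 1) → Sect2.TermValues (F.P p.K) (MatA N) (FluctV N) θ.τ9.M)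
      (Ek : SeqOfRecord F θ.ν θ.τ9.M (gOfRecord₁₃ F N θ p) p.K (k + 1) → ℝ),
      Sect2.UniversalE t ∧
      (∀ s', Sect2.LawsRT (sect2TowerOfRecord F N (FluctV N) p.K (settingOfRecord₁₃ F N θ p) (θ.Rz p.K) s' (t s'))
        (settingOfRecord₁₃ F N θ p).lf (k + 1)) ∧
      ((slotsTOfRecord F N θ.ν θ.τ9 (EOfRecord₁₃ F N θ) (wOfRecord₉ F N θ.toStage9Params) θ.ppSel p
          (gOfRecord₁₃ F N θ p) (k + 1) s =ᵐ[fieldMeasure (F.P p.K) (k + 1) (SU N)] 0) ∨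
        ∀ᵐ V' ∂fieldMeasure (F.P p.K) (k + 1) (SU N),
          slotsTOfRecord F N θ.ν θ.τ9 (EOfRecord₁₃ F N θ) (wOfRecord₉ F N θ.toStage9Params) θ.ppSel p
              (gOfRecord₁₃ F N θ p) (k + 1) s V' =
            sect2Slot F N (FluctV N) p.K (settingOfRecord₁₃ F N θ p) (θ.Rz p.K) (WtOfRecord₁₃ F N θ p) s (t s) (Ek s)
              (UbgOfRecord₁₃ F N θ p (k + 1) s) V') :=
  sLaw₁₃_succ_clause_of_Omega_empty_of_liveSel_of_hasResiduals F N θ p hres hsel hk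
    ((densitiesDescribed_leavesP_iff_sLaw₁₃_all_sep F N θ p w h hC).1 hD (k + 1) hk) s hΩ

end NodeFaces

section NodeFacesOfRecord

variable (p : B12.RunParams) (w : WorldP) (h : (theta13LiveOfRecord F N).Provisos₁₃Sep F N)

/-- **★★★ AT A WORLD BOUND TO THE v1.2 DATUM OF THE WITNESS OF RECORD: N11's node conclusion `densitiesDescribed (leavesP w p)` ⇒ the `SLaw`-side clause at
every no-expansion sequence of every level `k < K` — no further hypothesis** (the datum binder `h : Provisos₁₃Sep θ₁₃` is K0⁗'s own).  At `k = 0` this is the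
input of seat dag-n11-d's kernel necessary conditions at this witness, sourced from the NODE CONCLUSION. [cite: Balaban1988Convergent, Thm 1 p.262, (3.25) p.270, Theorem p.245, (3.16) p.268, (3.22) p.269; Balaban1989LargeFieldI, (0.3)–(0.4) p.176] -/
theorem sLaw₁₃_succ_clause_of_Omega_empty_of_densitiesDescribed_theta13LiveOfRecord
    (hC : w.C = (datumOfRecord₁₃Sep F N (theta13LiveOfRecord F N) h).C) (hD : (leavesP w p).densitiesDescribed) {k : ℕ} (hk : k < p.K)
    (s : SeqOfRecord F (theta13LiveOfRecord F N).ν (theta13LiveOfRecord F N).τ9.M (gOfRecord₁₃ F N (theta13LiveOfRecord F N) p) p.K (k + 1)) (hΩ : s.Ω (k + 1) = ∅) :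
    ∃ (t : SeqOfRecord F (theta13LiveOfRecord F N).ν (theta13LiveOfRecord F N).τ9.M (gOfRecord₁₃ F N (theta13LiveOfRecord F N) p) p.K (k + 1) → Sect2.TermValues (F.P p.K) (MatA N) (FluctV N) (theta13LiveOfRecord F N).τ9.M)
      (Ek : SeqOfRecord F (theta13LiveOfRecord F N).ν (theta13LiveOfRecord F N).τ9.M (gOfRecord₁₃ F N (theta13LiveOfRecord F N) p) p.K (k + 1) → ℝ),
      Sect2.UniversalE t ∧
      (∀ s', Sect2.LawsRT (sect2TowerOfRecord F N (FluctV N) p.K (settingOfRecord₁₃ F N (theta13LiveOfRecord F N) p) ((theta13LiveOfRecord F N).Rz p.K) s' (t s'))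
        (settingOfRecord₁₃ F N (theta13LiveOfRecord F N) p).lf (k + 1)) ∧
      ((slotsTOfRecord F N (theta13LiveOfRecord F N).ν (theta13LiveOfRecord F N).τ9 (EOfRecord₁₃ F N (theta13LiveOfRecord F N)) (wOfRecord₉ F N (theta13LiveOfRecord F N).toStage9Params) (theta13LiveOfRecord F N).ppSel p
          (gOfRecord₁₃ F N (theta13LiveOfRecord F N) p) (k + 1) s =ᵐ[fieldMeasure (F.P p.K) (k + 1) (SU N)] 0) ∨
        ∀ᵐ V' ∂fieldMeasure (F.P p.K) (k + 1) (SU N),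
          slotsTOfRecord F N (theta13LiveOfRecord F N).ν (theta13LiveOfRecord F N).τ9 (EOfRecord₁₃ F N (theta13LiveOfRecord F N)) (wOfRecord₉ F N (theta13LiveOfRecord F N).toStage9Params) (theta13LiveOfRecord F N).ppSel p
              (gOfRecord₁₃ F N (theta13LiveOfRecord F N) p) (k + 1) s V' =
            sect2Slot F N (FluctV N) p.K (settingOfRecord₁₃ F N (theta13LiveOfRecord F N) p) ((theta13LiveOfRecord F N).Rz p.K) (WtOfRecord₁₃ F N (theta13LiveOfRecord F N) p) s (t s) (Ek s)
              (UbgOfRecord₁₃ F N (theta13LiveOfRecord F N) p (k + 1) s) V') :=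
  sLaw₁₃_succ_clause_of_Omega_empty_theta13LiveOfRecord F N p hk
    ((densitiesDescribed_leavesP_iff_sLaw₁₃_all_sep F N (theta13LiveOfRecord F N) p w h hC).1 hD (k + 1) hk) s hΩ

/-- **★★★ … AND FROM A NON-VACUOUS N11 CONJUNCT `Dag.B14_main (leavesP w p)` AT THAT WORLD** (in-edge leaves, small-field implication, flow control and interval
hypothesis read TRUE; the `rOperation` antecedent is `…LiveRstep.rOperation_leavesP_theta13LiveOfRecord`, a closed theorem). [cite: Balaban1988Convergent, Thm 1 p.262, (3.25) p.270, Theorem p.245, p.244, (3.16) p.268; Balaban1989LargeFieldI, (0.3)–(0.4) p.176] -/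
theorem sLaw₁₃_succ_clause_of_Omega_empty_of_b14_main_theta13LiveOfRecord
    (hC : w.C = (datumOfRecord₁₃Sep F N (theta13LiveOfRecord F N) h).C)
    (hup : w.up p = upOfRecord₅C F N ((theta13LiveOfRecord F N).toStage5₁₃ F N) p) (h14 : Dag.B14_main (leavesP w p))
    (h7 : (leavesP w p).b7) (h8 : (leavesP w p).b8) (h9 : (leavesP w p).b9) (h10 : (leavesP w p).b10) (h11 : (leavesP w p).b11)
    (hsf : (leavesP w p).smallCouplings → (leavesP w p).smallFieldInductive) (hfc : (leavesP w p).smallCouplings → (leavesP w p).flowControl)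
    (hsc : (leavesP w p).smallCouplings) {k : ℕ} (hk : k < p.K)
    (s : SeqOfRecord F (theta13LiveOfRecord F N).ν (theta13LiveOfRecord F N).τ9.M (gOfRecord₁₃ F N (theta13LiveOfRecord F N) p) p.K (k + 1)) (hΩ : s.Ω (k + 1) = ∅) :
    ∃ (t : SeqOfRecord F (theta13LiveOfRecord F N).ν (theta13LiveOfRecord F N).τ9.M (gOfRecord₁₃ F N (theta13LiveOfRecord F N) p) p.K (k + 1) → Sect2.TermValues (F.P p.K) (MatA N) (FluctV N) (theta13LiveOfRecord F N).τ9.M)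
      (Ek : SeqOfRecord F (theta13LiveOfRecord F N).ν (theta13LiveOfRecord F N).τ9.M (gOfRecord₁₃ F N (theta13LiveOfRecord F N) p) p.K (k + 1) → ℝ),
      Sect2.UniversalE t ∧
      (∀ s', Sect2.LawsRT (sect2TowerOfRecord F N (FluctV N) p.K (settingOfRecord₁₃ F N (theta13LiveOfRecord F N) p) ((theta13LiveOfRecord F N).Rz p.K) s' (t s'))
        (settingOfRecord₁₃ F N (theta13LiveOfRecord F N) p).lf (k + 1)) ∧
      ((slotsTOfRecord F N (theta13LiveOfRecord F N).ν (theta13LiveOfRecord F N).τ9 (EOfRecord₁₃ F N (theta13LiveOfRecord F N)) (wOfRecord₉ F N (theta13LiveOfRecord F N).toStage9Params) (theta13LiveOfRecord F N).ppSel p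
          (gOfRecord₁₃ F N (theta13LiveOfRecord F N) p) (k + 1) s =ᵐ[fieldMeasure (F.P p.K) (k + 1) (SU N)] 0) ∨
        ∀ᵐ V' ∂fieldMeasure (F.P p.K) (k + 1) (SU N),
          slotsTOfRecord F N (theta13LiveOfRecord F N).ν (theta13LiveOfRecord F N).τ9 (EOfRecord₁₃ F N (theta13LiveOfRecord F N)) (wOfRecord₉ F N (theta13LiveOfRecord F N).toStage9Params) (theta13LiveOfRecord F N).ppSel p
              (gOfRecord₁₃ F N (theta13LiveOfRecord F N) p) (k + 1) s V' =
            sect2Slot F N (FluctV N) p.K (settingOfRecord₁₃ F N (theta13LiveOfRecord F N) p) ((theta13LiveOfRecord F N).Rz p.K) (WtOfRecord₁₃ F N (theta13LiveOfRecord F N) p) s (t s) (Ek s)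
              (UbgOfRecord₁₃ F N (theta13LiveOfRecord F N) p (k + 1) s) V') :=
  sLaw₁₃_succ_clause_of_Omega_empty_of_densitiesDescribed_theta13LiveOfRecord F N p w h hC
    (h14 h7 h8 h9 h10 h11 hsf hfc (rOperation_leavesP_theta13LiveOfRecord F N p w hup) hsc) hk s hΩ

end NodeFacesOfRecord

end Literature.MathematicalPhysics.QuantumFieldTheory.Balaban1983to89.B16RLeafRecord13LiveSLaw

end
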